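import Summits.BirchSwinnertonDyer.BirchSwinnertonDyer.Theorems.EisensteinDepletionAtTwoStarE1MNSFDoor
import Summits.BirchSwinnertonDyer.BirchSwinnertonDyer.Theorems.EisensteinDepletionAtTwoStarSigmaGlue
import Summits.BirchSwinnertonDyer.BirchSwinnertonDyer.Theorems.EisensteinDepletionAtTwoStarOptBSFOddCover
import Summits.BirchSwinnertonDyer.BirchSwinnertonDyer.Theorems.EisensteinDepletionAtTwoStarOptBSFShimuraExponentLevels
import Summits.BirchSwinnertonDyer.BirchSwinnertonDyer.Theorems.EisensteinDepletionAtTwoStarOptBSFTypeAResidue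
import Summits.BirchSwinnertonDyer.BirchSwinnertonDyer.Theorems.EisensteinDepletionAtTwoStarOptBSFMidWalk
import Summits.BirchSwinnertonDyer.BirchSwinnertonDyer.Theorems.EisensteinDepletionAtTwoStarOptBSFSigmaNodeSeventeen
import Summits.BirchSwinnertonDyer.BirchSwinnertonDyer.Theorems.EisensteinDepletionAtTwoStarOptBSFSigmaNodeSeventeenFree
import Literature.NumberTheory.EllipticCurves.ManinConstantDeuringTwistProofs
import Summits.BirchSwinnertonDyer.BirchSwinnertonDyer.Theorems.EisensteinDepletionAtTwoStarOptBSFSigmaNodePrime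
import Summits.BirchSwinnertonDyer.BirchSwinnertonDyer.Theorems.EisensteinDepletionAtTwoStarOptBSFSigmaNodeCusp
import Summits.BirchSwinnertonDyer.BirchSwinnertonDyer.Theorems.EisensteinDepletionAtTwoStarOptBSigmaNodeFifteenAll
import Summits.BirchSwinnertonDyer.BirchSwinnertonDyer.Theorems.EisensteinDepletionAtTwoStarDoorThreePrints
import Summits.BirchSwinnertonDyer.BirchSwinnertonDyer.Theorems.EisensteinDepletionAtTwoStarOddManinDoor
import Summits.BirchSwinnertonDyer.BirchSwinnertonDyer.Theorems.EisensteinDepletionAtTwoStarDoubleLiftFalse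
import Summits.BirchSwinnertonDyer.BirchSwinnertonDyer.Theorems.EisensteinDepletionAtTwoStarEtaleLiftSecondPoint
import Summits.BirchSwinnertonDyer.BirchSwinnertonDyer.Theorems.EisensteinDepletionAtTwoStarEvenKummerForm
import Summits.BirchSwinnertonDyer.BirchSwinnertonDyer.Theorems.EisensteinDepletionAtTwoStarOptBNSFParityGroup
import Summits.BirchSwinnertonDyer.BirchSwinnertonDyer.Theorems.EisensteinDepletionAtTwoStarOptBNSFCongruenceCore
import Literature.NumberTheory.EllipticCurves.ManinConstantGamma1ModularDegree
import Literature.NumberTheory.EllipticCurves.TwoTorsionHalfPeriodProofs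
import HarnessLib

/-!
# Line `star` on crux E1M `DepletedLambdaLawAtTwoMod` (stmt-BirchSwinnertonDyer-20341, ASIDE since rev 19) — v19 (lead star-p1 GEN 21, 2026-08-29)

WHAT CHANGED SINCE v18 (GEN 21, third step).  ALL THREE RESEARCH STUBS OF THE PARITY SPLIT ARE TREE THEOREMS; ABBES–ULLMO HAS LEFT THE DOOR.
* S5 `stub_doubleLiftFalse` = `EvenBranch.stub_doubleLiftFalse` (Theorems/…StarDoubleLiftFalse, p736269);
* S4 `stub_etaleLiftSecondPoint` = `SigmaNode.stub_etaleLiftSecondPoint` (Theorems/…StarEtaleLiftSecondPoint(+Prelims), p738087/p736787);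
* S2 `stub_evenKummerForm` = `EvenBranch.stub_evenKummerForm` (Theorems/…StarEvenKummerForm), whose heart is the EVEN SQUARE LAW
  `EvenBranch.evenSquareLaw_int` (Theorems/…StarEvenSquareLaw, p737902): for an INTEGRAL 2-torsion point `(x₀, y₀)` and `B² = X(T) − x₀T²`, `B(0) = 1`,
  `B([2]T) ∈ ℤ⟦T⟧` — pure power-series algebra from the tree's cleared duplication identities (`B([2]T)·K = M·G`, `K(0) = 1`); with `Z_q = [2]Z_{q/2}`
  (`q` even) the substituted square root `B(Z_q)` is integral, and line nsf's `X₁(N)` engine (`sqrtCuspForm_even`, `KummerAlg.kummerAlg_of_substInt`) gives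
  the anti-invariant integral cusp form.
So v19 has TWO stubs, BOTH PRINTS: `stub_cuspNonsingular` (F) and `stub_ubd` (UBD); `Holds.stub_evenKummerForm/etaleLiftSecondPoint/doubleLiftFalse` are
one-line PROOFS.  **E1M (all levels) ⇐ modularity + (F) + UBD** (`DepletedLambdaLawAtTwoMod_of`; tree twin
`EvenBranch.depletedLambdaLawAtTwoMod_of_cuspNonsingular_ubd`, Theorems/…StarE1MTwoPrints).  HONEST FRAMING: CONDITIONAL on two published facts;
E1M_NSF / the leaf T-r3₂ / BSD are NOT proved (PARTITION D-0054: none — r_an ≥ 2, axis S0; no S0 motion).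

HISTORY (v18, GEN 21, second step).

WHAT CHANGED SINCE v17 (GEN 21, second step).  THE ABBES–ULLMO PRINT IS REPLACED BY THREE KERNEL-SIZED RESEARCH STUBS — «the parity split».
v17 isolated the exact residue (OddManin₂) «q odd» of Abbes–Ullmo Thm A.  v18 DERIVES (OddManin₂) (`oddManinAtTwo_of_stubs`, kernel-checked glue) from
modularity, (F), UBD and three new stubs, by contradiction from a hypothetical EVEN Manin constant q:
* `stub_evenKummerForm` (S2, RESEARCH, L — Kummer side): for even `q` and ANY étale rational 2-torsion abscissa `x₀` of the optimal `W₀` (half-period `λ`),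
  the UNTWISTED parity cover `Γ′_{x₀} = {γ ∈ Γ₁(N) : q{∞,γ∞}_f ∈ ℤλ + 2Λ₀}` — if proper — carries a non-zero anti-invariant cusp form with an integral
  multiple at `∞` (exactly `CongruenceCore`'s input).  MECHANISM (new datum, GEN 21, work/evenc: 15a1/21a1/33a1/39a1/45a1/65a1, every étale `x₀`, `c ∈ {2,4,6}`):
  the EVEN-MULTIPLE SQUARE LAW — `V_c := Z_c²(x(Z_c) − x₀)` is a square in `ℤ₂⟦q⟧` for even `c` (class `[Θ_N]^{c mod 2}`; `[2]^*(x − x₀) = h²`), so the Kummer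
  function `sqrt(x∘φ₀ − x₀)·(−x/y)∘φ₀` has INTEGRAL expansion `sqrt(V_q)` with NO η-companion; the engines of line nsf's THEOREM A (`ParityGroup`,
  `KummerForm`, `KummerQExp`, `KummerAlg`) are the model.  GLUE (proved here): `evenLift_of_evenKummerForm` — S2 + UBD (`CongruenceCore.false_of_antiinvariant_integral_cuspForm_wt`)
  ⇒ LIFT(x₀): `∀ γ ∈ Γ₁(N), q{∞,γ∞}_f ∈ ℤλ + 2Λ₀` (i.e. `Λ₁(f) ⊆ ℤλ_f + 2Λ_f`: the étale `P₀` lies in the kernel of the dual Stevens isogeny `E₀ → E₁`).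
* `stub_etaleLiftSecondPoint` (S4, RESEARCH, M — (F) side, clone of GEN 18's `SigmaNode.sigmaNode_of_cuspImageNonsingular` with ÉTALE bookkeeping): (F) +
  LIFT(x₀) for an étale `x₀` ⇒ the cusp images of the lifted `X₁(N)`-parametrisation of `W′ = ℂ/(ℤλ + 2Λ₀) = W₀/⟨P₀⟩` are the FORMAL generator `T′` of
  `ker(W′ → W₀)`; non-singularity of `T′` at every odd prime forces `α² − 32β = ±2^k` (`α = b₂ + 12x₀` ODD, `β = b₄ + x₀b₂ + 6x₀²`), hence `α² − 32β = 1`,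
  hence the 2-division cubic splits as `X(X + (α−1)/8)(X + (α+1)/8)`: a SECOND étale rational 2-torsion point `x₁ ≠ x₀` exists.  (Data: for the optimal
  curves above `α² − 32β ∈ {81, 625, 49, 81, 729, 121, …}` = powers of the odd bad primes at étale points, `= ±256` at the formal point — the node law.)
* `stub_doubleLiftFalse` (S5, RESEARCH, M — (F) side): LIFT(x₀) ∧ LIFT(x₁) for two distinct étale points ⇒ `q·Λ₁(f) ⊆ 2Λ₀` ⇒ (q even!) `τ ↦ (q/2)∫f` is an
  `X₁(N)`-parametrisation of `W₀` itself whose cusp images exhaust `W₀[2]` (by `Λ₀ = q·Λ_f`) ⇒ by (F) every rational 2-torsion point of `W₀` is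
  non-singular at every prime ⇒ impossible at an odd bad prime `p ∣ N` (`N = N_{W₀} ≥ 11` odd): there two roots of the 2-division cubic collide mod `p`
  and `Φ_x(P) = −(x_P − x_Q)(x_P − x_R)/2`, `Φ_y(P) = 0`.
NUMERICAL SUPPORT for the whole mechanism (work/f2test, exact modular-symbol periods over `Γ₀(N)` with monodromy bookkeeping): for 15a1, 17a1, 21a1, 33a1,
39a1, 73a1 the 2-part of `V₀ = E₀ ∩ Σ_N` is generated by the FORMAL point and no étale point satisfies LIFT; `|V₀| = 4, 4, 2, 2, 2, 2` (and `5, 3, 1, 3, 1, 1`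
for 11a1, 19a1, 37a1, 37b1, 45a1, 65a1 — Mazur's `n = num((N−1)/12)` at prime level).
So v18 has FIVE stubs: `stub_cuspNonsingular` (F, PRINT), `stub_ubd` (PRINT), `stub_evenKummerForm` (L), `stub_etaleLiftSecondPoint` (M),
`stub_doubleLiftFalse` (M); `stub_oddManinAtTwo` and `stub_abbesUllmo` are kept as `def`s — the former DERIVED (`oddManinAtTwo_of_stubs`), the latter for
the record (`stub_oddManinAtTwo_of_abbesUllmo` still gives the v17 door).  **E1M (all levels) ⇐ modularity + (F) + UBD + {S2, S4, S5}**: when the three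
research stubs land, Abbes–Ullmo LEAVES the door and E1M rests on TWO published facts {(F), UBD}.  HONEST FRAMING: CONDITIONAL; the research stubs are
open; E1M_NSF / the leaf T-r3₂ / BSD are NOT proved (PARTITION D-0054: none — r_an ≥ 2, axis S0; no S0 motion).

HISTORY (v17, GEN 21, first step).

WHAT CHANGED SINCE v16 (GEN 21).  THE ABBES–ULLMO PRINT IS CUT TO ITS EXACT RESIDUE.  Abbes–Ullmo Thm A
(`abbesUllmo_not_dvd_maninConstant_of_not_dvd_level`: every prime `p ∤ N`, every optimal datum) entered v16 at exactly one point —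
`KummerDoor.discrepancyCover_of` turned it into `Odd q` for the `X₀(N)`-lattice-optimal minimal model `W₀` (`Λ₀ = q·Λ_f`, `q ∈ ℤ` by the tree
theorem `edixhoven_optimalManinConstant_integral_holds`), feeding K-Θ.  v17 registers that residue itself as the stub:
  `stub_oddManinAtTwo` (OddManin₂): for every globally minimal elliptic `W₀/ℚ` with newform `f ∈ S₂(Γ₀(N))`, `2 ∤ N`, `W₀` good ORDINARY at `2`,
  Néron-type lattice `Λ₀ = q·Λ_f` EXACTLY (`q ∈ ℤ`, `q ≠ 0`) and a rational `2`-torsion abscissa NOT ramified at `2`: `q` is odd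
— the case `p = 2` of Thm A restricted to the curves the door meets (`stub_oddManinAtTwo_of_abbesUllmo`: A–U ⇒ (OddManin₂), tree
`KummerDoor.oddManinAtTwo_of_abbesUllmo`), through the landed door `KummerDoor.depletedLambdaLawAtTwoMod_of_cusp_oddManin_ubd`
(Theorems/…StarOddManinDoor, p734118: `discrepancyCover` re-threaded, `StarGO2Sigma`, E1M, E1M_NSF from (F) + (OddManin₂) + UBD).  WHY THIS IS THE
RIGHT CUT (repair census GEN 21, Cruxes/…/Lines/star-AU-parity-gen21.md): a hypothetical EVEN `q` makes the UNTWISTED Kummer function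
`sqrt(x∘φ₀ − x₀)·(−x/y)∘φ₀` integral at `∞` (even-multiple square law: `Z_c²(x(Z_c) − x₀)` is a square in `ℤ₂⟦q⟧` for even `c`, numerics
15a1/21a1/33a1/39a1; `[2]^*(x − x₀) = h²`), so UBD + Wohlfahrt (`CongruenceCore`, verbatim) give `Λ₁(f) ⊆ ℤλ_f + 2Λ_f`, i.e. the étale point `P₀`
lies in the kernel of the dual Stevens isogeny `E₀ → E₁`; what kills that is the 2-primary étaleness of the cusp-image group on `E₁` — (F₂), the
prime-2 companion of (F), NOT in print (Vatsal 2005 treats odd ℓ only) — so (OddManin₂) is exactly the open residue, and Abbes–Ullmo Thm A (IN PRINT)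
is its only printed source today.  v17 has THREE stubs: `stub_cuspNonsingular` (F, PRINT), `stub_oddManinAtTwo` (PRINT-RESIDUE: ⟸ Abbes–Ullmo;
would also follow from (F₂) + UBD), `stub_ubd` (PRINT); `stub_abbesUllmo` is kept as a plain `def` (statement of the print) for the record and
nothing on the composition path uses it.  **E1M (all levels) is a tree theorem MODULO {(F), (OddManin₂), UBD} + modularity**, hence modulo the
three published facts {(F) CES 2003 §6.1.2 / KM 12.6 / ATAEC IV.9.1, Abbes–Ullmo 1996 Thm A, Calegari–Dimitrov–Tang 2025}.  HONEST FRAMING: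
CONDITIONAL on named/displayed facts; E1M_NSF / the leaf T-r3₂ / BSD are NOT proved (PARTITION D-0054: none — r_an ≥ 2, axis S0; no S0 motion).

HISTORY (v16, GEN 20).

WHAT CHANGED SINCE v15 (GEN 20).  THE OPTIMAL `Γ₁(N)`-DATUM PRINT IS GONE: `stub_gamma1Datum` (`exists_optimal_gamma1ParametrizationData`, CES 2003 §6.1 /
Stevens 1989) entered v15 only through the NON-squarefree half of `StarOptB` (line nsf's door `NsfDoorPrint.starOptBNSF_of_print`, with modularity); the
squarefree half came from the node law (N256) through (T1) ∧ (T2).  In that chain the hypothesis `Squarefree N_W` was CONSUMED AT EXACTLY ONE POINT — the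
level bookkeeping `Δ(W₀) = 3⁴·5⁴ ⇒ 15 ∣ N = N_W squarefree ⇒ N = 15` excluding the `15a1` shape (`false_of_fifteenShape_free`) — and merely carried everywhere
else (…SigmaNodeMid, …MidWalk, …Positions, …SeventeenFree).  GEN 20 excludes the shape WITHOUT it (Theorems/…StarOptBSigmaNodeFifteenAll, p728424):
`+256 ∧ α = −34` pins `(c₄, c₆)(W₀) = (481, 4879)`, i.e. `W₀ ≅ 15a1 = [1,1,1,−10,−10] = X₀(15)` over `ℚ` (as GEN 19 pinned the `−256` shape to `17a1`);
`N_{15a1} = 15` (semistable integer model, `gcd(Δ, c₄) = 1`, conductor = radical of `Δ = 15⁴`, tree engine `conductorNorm_baseChange_int_of_isCoprime`); and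
`N_W = N_{W₀}` because `W ~ W₀` (same newform, Faltings) with good reduction at `2` (Ogg–Saito, tree `IsogenyMuShift.conductorNorm_eq_of_isIsogenous_of_hasGoodReductionAtPrime_two`)
— contradiction with `N_W ≠ 15` at EVERY level.  Hence (T2′), the MID walk (T2) and the positions glue run at every level
(Theorems/…StarDoorThreePrints: `MidWalk.optimalNotMidPointed_of_partnerNotCentre_all`, `SfPositions.starOptB_of_positions_all`,
`SigmaNode.starOptB_of_sigmaNode_all`, `SigmaNode.starOptB_of_twoPrints : (F) → UBD → StarOptB`), and the composition below no longer mentions the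
`Γ₁`-datum: v16 has THREE stubs, ALL PRINTS — `stub_cuspNonsingular` (F), `stub_abbesUllmo`, `stub_ubd`; tree door by name
`SigmaNode.depletedLambdaLawAtTwoMod_of_threePrints`.  `stub_gamma1Datum` is kept as a plain `def` (statement of the print) for the record; nothing on the
composition path uses it.  (Bonus for the tenure planner: `SigmaNode.starOptBNSF_of_twoPrints` gives the non-squarefree crux `StarOptBNSF` (27047) from
(F) + UBD as well — an alternative to line nsf's `Γ₁`-datum door, a trade there, a removal here.)
**E1M (all levels) is a tree theorem MODULO THREE PUBLISHED FACTS** {(F) cusp images reduce into the identity component (CES 2003 §6.1.2 / KM 12.6 / ATAEC IV.9.1),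
Abbes–Ullmo 1996 Thm A (line kummer's `StarGO2Sigma` half: the `X₀(N)`-Manin constant is odd at odd `N`), UBD (Calegari–Dimitrov–Tang 2025)} + modularity
(E1M's own hypothesis).  HONEST FRAMING: CONDITIONAL on named facts; E1M_NSF / the leaf T-r3₂ / BSD are NOT proved (PARTITION D-0054: none — r_an ≥ 2, axis S0;
no S0 motion).

HISTORY (v15, GEN 19, second step).

WHAT CHANGED SINCE v14 (GEN 19, second step).  `stub_edixhoven` IS DISCHARGED BY NAME: Edixhoven 1991 Prop. 2 in lattice form
(`edixhoven_optimalManinConstant_integral`: the scale `q` with `Λ_{W₀} = q·Λ_f` is an integer) is a TREE THEOREM,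
`Literature.NumberTheory.EllipticCurves.ModularForms.edixhoven_optimalManinConstant_integral_holds` (Literature/…/ManinConstantDeuringTwistProofs: prime by prime
through the formal group — good/multiplicative primes, additive `p ≥ 5`, additive `3` by the Legendre twist, additive `2` by the Deuring twist; axioms standard),
so `Holds.stub_edixhoven` below is a one-line PROOF, not a `sorry`.  v15 has FOUR stubs, ALL PRINTS: `stub_cuspNonsingular` (F), `stub_gamma1Datum`,
`stub_abbesUllmo`, `stub_ubd`; tree door by name `SigmaNode.depletedLambdaLawAtTwoMod_of_fourPrints` (Theorems/…StarDoorFourPrints).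
**E1M (all levels) is a tree theorem MODULO FOUR PUBLISHED FACTS** {(F) cusp images reduce into the identity component (CES 2003 §6.1.2 / KM 12.6 / ATAEC IV.9.1),
the optimal `Γ₁(N)`-datum (CES 2003 §6.1 / Stevens 1989), Abbes–Ullmo 1996 Thm A, UBD (Calegari–Dimitrov–Tang 2025)} + modularity (E1M's own hypothesis).
HONEST FRAMING: CONDITIONAL on named facts; E1M_NSF / the leaf T-r3₂ / BSD are NOT proved (PARTITION D-0054: none — r_an ≥ 2, axis S0; no S0 motion).

HISTORY (v14, GEN 19, first step).

WHAT CHANGED SINCE v13 (GEN 19).  THE TWO CLASSIFICATION PRINTS ARE GONE: `stub_setzer` (Setzer 1975) and `stub_cremona17` (Cremona's conductor-17 table)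
entered v13 only through (T2′) «the MID point's partner is not a centre» (Theorems/…SigmaNodeFifteen, …SigmaNodeSeventeen), i.e. through the two explicit
shapes the node law leaves for a MID point with a centre partner.  Both are now excluded IN THE KERNEL (Theorems/…SigmaNodeFifteenFree, …SeventeenModels,
…SeventeenClassWalk, …SigmaNodeSeventeenFree; all fact-free):
* `+256`, `α = −34` (the `15a1` shape, `Δ(W₀) = 3⁴·5⁴`): `3` and `5` DIVIDE the minimal discriminant of `W₀`, so both are bad primes (AEC VII.5.1(a)) and `15 ∣ N`;
  with `N ∣ 15` this is `N = 15`, excluded — no classification of prime conductors (`SigmaNode.false_of_fifteenShape_free`);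
* `−256`, `α = ±30` (the `17a1` shape, `Δ(W₀) = −17⁴`): `c₆ ≡ −a₁⁶ ∈ {0,3} (mod 4)` on an integral model kills `α = −30` (`c₆ = −12015 ≡ 1`); `α = 30` pins
  `(c₄, c₆) = (33, 12015)`, i.e. `W₀ ≅ 17a1` over `ℚ`; the habitat curve `W` is isogenous to `W₀` (Faltings, tree), the isogeny factors through a globally minimal
  `V` as (2-power `W₀ → V`) ∘ (odd `W → V`) (tree `stub_isogenyFactor`), the 2-power isogeny class of `17a1` is walked EXPLICITLY — rational 2-torsion lists of
  `17a1–a4`, six explicit codomain identifications, the explicit 2-isogeny step with its codomain MODEL `[0, −α/2, 0, α²/16 − 2β, 0]`, and the kernel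
  bookkeeping of line nsf's walk (`SeventeenClass.exists_smul_mem_of_twoPower_isogeny`) — so `V ≅ 17aⱼ`; odd isogenies transport the unique rational
  2-torsion point with both type bits (tree `stub_oddIsoUnique/Arch/TwoAdic`); and the case analysis on the four models (`not_prop514_of_smul_eq_cremona17`)
  contradicts the habitat type (`SigmaNode.false_of_seventeenShape_free`).
So (T2′) ⇐ (N256) + {UBD, Edixhoven} (`SigmaNode.partnerNotCentre_of_sigmaNode_free`), and v14 has FIVE stubs, ALL PRINTS, all of modular-parametrisation
type: `stub_cuspNonsingular` (F), `stub_edixhoven`, `stub_gamma1Datum`, `stub_abbesUllmo`, `stub_ubd`; the composition `DepletedLambdaLawAtTwoMod_of`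
concludes the crux BY NAME (tree door: `SigmaNode.depletedLambdaLawAtTwoMod_of_fivePrints`, Theorems/…StarDoorFivePrints).  E1M (all levels) is a tree
theorem MODULO FIVE PUBLISHED FACTS (modularity being E1M's own hypothesis) — superseded by v15 above (four).  HONEST FRAMING: E1M is thereby CONDITIONAL on named facts, not proved
outright; E1M_NSF / the leaf T-r3₂ / BSD are NOT proved (PARTITION D-0054: none — r_an ≥ 2, axis S0; no S0 motion).  `stub_setzer`, `stub_cremona17` are
kept as plain `def`s (statements of the two prints) for the record; nothing on the composition path uses them.

HISTORY (v13, GEN 18).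

WHAT CHANGED SINCE v12 (GEN 18).  THE LAST RESEARCH STUB IS GONE: the NODE LAW (N256) is now DERIVED, at EVERY level, from a seventh PRINT.
GEN 17 had sourced the node law («the formal Shimura-type 2-torsion point `P` of the `X₀(N)`-lattice-optimal `W₀` sits on the node at every bad
prime») to the connectedness of the fibres of `J₁(N)` (Conrad–Edixhoven–Stein 2003, prime level only).  Far less is needed, and what is needed is
printed: ALL cusps `⟨d⟩∞` over `∞ ∈ X₀(N)` are `ℤ`-points of the SMOOTH `ℤ`-curve `X_μ(N)` (CES 2003 §6.1.2, proof of Lemma 6.1.6), whose fibre at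
`p` is the connected `μ`-ordinary Igusa curve (Igusa 1968; Katz–Mazur Thm 12.6.1 / Cor 12.6.2), so by the Néron mapping property every cusp image
under an `X₁(N)`-parametrisation `X_μ(N) → E` lies in the identity component of the Néron model of `E` at every prime, i.e. (ATAEC IV.9.1) reduces
NON-SINGULARLY on the minimal model.  This is the new tree named fact
  `gamma1Parametrization_cuspImage_nonsingularReduction` (Literature/NumberTheory/EllipticCurves/Gamma1ParametrizationCuspIdentityComponent.lean,
  p715749; sibling of `optimalGamma1Parametrization_cusp_rational`) = the PRINT stub `stub_cuspNonsingular` below,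
and the KERNEL `SigmaNode.sigmaNode_of_cuspImageNonsingular` (Theorems/…StarOptBSFSigmaNodeCusp + …CuspPrelims, GEN 18) derives v10/v11's
`stub_sigmaNode` (N256 at ALL levels) from it and Edixhoven: the Kummer-parity hypothesis puts `c₀Λ₁(f)` inside the Néron lattice `2Λ₀ + ℤλ` of
the globally minimal 2-isogenous partner `W′ = W₀/P` (Vélu on the analytic side, `k = ±2` by the 2-adic count for a formal `P`); the image of a
cusp `γ∞` with `c₀{∞,γ∞}_f ∉ 2Λ₀ + ℤλ` is the generator `T̄` of the dual kernel on `W′` (`℘`-value `−2e₀`), with `Φ_x(T̄) = −(α² − 32β)/256`;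
non-singularity of `T̄` at every odd prime makes `α² − 32β` free of odd primes, and `4Δ = β²(α² − 32β)` with `Δ`, `8β` odd pins `±256`.
So v13 has SEVEN stubs, ALL PRINTS: `stub_cuspNonsingular` (NEW), `stub_edixhoven`, `stub_cremona17`, `stub_setzer`, `stub_gamma1Datum`,
`stub_abbesUllmo`, `stub_ubd`; (N256) (`stub_sigmaNode`, `stub_sigmaNodeCompositeOr17`), (SQΣ_f), (T1), (T2′), (T2), (T2‴) are `def`s and
DERIVED; the composition `DepletedLambdaLawAtTwoMod_of` concludes the crux BY NAME.  **E1M (all levels) is a tree theorem MODULO SEVEN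
PUBLISHED FACTS** (modularity being E1M's own hypothesis).  HONEST FRAMING: E1M is thereby CONDITIONAL on named facts, not proved outright;
E1M_NSF / the leaf T-r3₂ / BSD are NOT proved (PARTITION D-0054: none — r_an ≥ 2, axis S0; no S0 motion).

HISTORY (v12, GEN 17).

WHAT CHANGED SINCE v11 (GEN 17).  THE ARCHIMEDEAN RESEARCH STUB IS GONE.  In the `−256` (Neumann–Setzer-shape) branch the MID walk again only needs the MID point's
partner not to be a centre, and the centre condition `β/2 ∈ ℚ²` is again finite Diophantine (Theorems/…StarOptBSFSigmaNodeSeventeen): `α = 2a`, `a` odd,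
`a² + 64 = c²` ⇒ `a = ±15` ⇒ `α = ±30`, `Δ(W₀) = −17⁴` — the shape of `17a1 = X₀(17)` — so the level is `17`, where Cremona's table (tree named fact
`Cremona1997_conductor_seventeen_classification`, a sixth PRINT `stub_cremona17`) shows there is no habitat curve.  Hence
  (T2′) ⇐ (N256) + PRINTS {UBD, Edixhoven, Setzer, Cremona-17} (`SigmaNode.partnerNotCentre_of_sigmaNode_of_prints`), (T2) ⇐ (T2′) (MID walk),
and v12 has ONE research stub: the p-adic NODE LAW off the prime levels ≠ 17, `stub_sigmaNodeCompositeOr17` (N256 at composite level or N = 17;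
the prime levels ≠ 17 are DERIVED from Setzer by p706817, `sigmaNode_of_compositeOr17`), plus SIX prints (`stub_gamma1Datum`, `stub_abbesUllmo`, `stub_ubd`, `stub_edixhoven`,
`stub_setzer`, `stub_cremona17`); (T2‴), (T2), (T2′), (SQΣ_f), (T1) are kept as `def`s and DERIVED; the composition `DepletedLambdaLawAtTwoMod_of` concludes the crux
BY NAME.  THE SQUAREFREE RESIDUE OF E1M IS THE NODE LAW: «the formal Shimura 2-torsion point of the X₀(N)-optimal curve has complementary discriminant ±2⁸»
(⟸ connected fibres of J₁(N) at p ∥ N — Conrad–Edixhoven–Stein 2003 at prime level; open in print at composite level).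

HISTORY (v11, GEN 17).

WHAT CHANGED SINCE v10 (same GEN, second half).  The archimedean research stub (T2) `stub_optimalNotMidPointed` («no MID-pointed optimal curve in a habitat class
at squarefree N ≠ 15») is now DERIVED.  THE MID WALK (Theorems/…StarOptBSFMidWalkCore + …MidWalk, print-free): walking the 2-power isogeny from the
optimal curve towards the habitat curve with the invariant «ramified AND odd» (Greenberg's flip laws; two distinct rational abscissae are never both ramified nor
both odd) shows that a MID point `m` forces its 2-isogenous partner `W₀/⟨P_m⟩` to be a CENTRE, i.e. `(b₄ + m b₂ + 6m²)/2 ∈ ℚ²` — so (T2) ⟸ (T2′) «the partner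
is not a centre» (`MidWalk.optimalNotMidPointed_of_partnerNotCentre`); and under the node law the centre condition is a finite Diophantine equation
(Theorems/…StarOptBSFSigmaNodeMid: `+256`, `α = b₂ + 12m ≡ 2 mod 4`, `β/2 = (α² − 256)/64 ∈ ℚ² ⟺ α = ±34`, MID ⟹ `α = −34` = the `15a1` shape), so
(T2′) ⟸ UBD + Edixhoven + (N256) + «α ≠ −34» + «no −256 shape»; and the `15a1` shape `α = −34` forces `Δ(W₀) = 3⁴5⁴`, hence a level dividing 15
(Theorems/…StarOptBSFSigmaNodeFifteen: bad primes divide the minimal discriminant; `N = N_W` squarefree; `N = 1` excluded by Tate–Ogg, `N ∈ {3,5}` by SETZER's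
classification — a fifth PRINT `stub_setzer`), so at `N ≠ 15` all that is left of (T2) is the new research stub
* `stub_noSetzerShape` (T2‴, RESEARCH): «a MID point (ramified ∧ odd rational 2-torsion abscissa) of the lattice-optimal `W₀` of a habitat class at squarefree
  `N ≠ 15` does NOT have complementary discriminant `−256`» (no Neumann–Setzer shape `{r, e ± 2i}` inside a habitat class).  Data: among all 432 182 odd-conductor
  classes `N < 5·10⁵` the `−256` shape occurs exactly at the 90 PRIME levels `17`, `u² + 64` (optimal curve `E₀(u)` / `17a1`), whose classes are never habitat
  (tree: `not_prop514_of_prime_conductor`, mod Setzer, and the level-17 table); 0 occurrences at composite level.  Why it might fail: a Neumann–Setzer-shape optimal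
  curve in a habitat class at composite squarefree level — by Stevens at 2 + THEOREM A this needs `4 ∣ [Λ_f : Λ₁(f)]₂` (GEN 16's exponent doors exclude every
  level having a prime `p` with `v₂(p − a_p) = 1`).
So v11 has SEVEN stubs: `stub_sigmaNode` (N256, the p-adic node law) and `stub_noSetzerShape` (T2‴, the archimedean residue) RESEARCH, and the prints
`stub_gamma1Datum`, `stub_abbesUllmo`, `stub_ubd`, `stub_edixhoven`, `stub_setzer`; (T2), (T2′), (SQΣ_f), (T1) are kept as `def`s and DERIVED; the composition
`DepletedLambdaLawAtTwoMod_of` concludes the crux BY NAME.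

HISTORY (v10, GEN 17, first half).

WHAT CHANGED SINCE v9.1 (GEN 17).  The research stub (SQΣ_f) `stub_sigmaSquare` («a FORMAL Σ-type rational 2-torsion abscissa `r` of the lattice-optimal
`W₀` forces `Δ(W₀) = ±c²») is REPLACED by the sharper LOCAL statement it comes from and DERIVED from it (`sigmaSquare_of_sigmaNode`, one line of algebra;
tree file Theorems/…StarOptBSFSigmaNode):
* `stub_sigmaNode` (N256, RESEARCH — THE NODE LAW): «for such `r`, with `α = b₂ + 12r`, `β = b₄ + r b₂ + 6r²`, the complementary discriminant
  `α² − 32β` (the discriminant `B² − 16C` of the quadratic factor of the 2-division cubic carrying the two OTHER 2-torsion abscissae) equals `256` or `−256`».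
  Since `4Δ = β²(α² − 32β)`, this gives `Δ = ±(8β)²`.  MEANING: at every odd prime the two non-`P` roots stay distinct, i.e. the Shimura point `P` reduces to
  the NODE of `W₀ mod p` at every `p ∣ N` (equivalently `Δ_min(W₀) = ±Δ_min(W₀/P)²`; dually the Shimura kernel `T ⊂ W₁` is TORIC at every `p ∣ N`), and the
  2-adic normalisation (`r = m/4`, `v₂(β) = −3`, `Δ` odd) pins `|α² − 32β| = 2⁸`.  SOURCE of the law: `T` is generated by images of rational cuspidal divisors of
  `X₁(N)`, so it lies in the identity component of `W₁` at `p` as soon as the Néron model of `J₁(N)` has connected fibre at `p` — Conrad–Edixhoven–Stein 2003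
  Thm. 1.1.1 at PRIME level (in print); at composite squarefree level «not worked out» (loc. cit. p. 328) — this is now the exact print-shaped gap of (T1).
  DATA (GEN 17, Cremona, exact): over ALL 432 182 isogeny classes of odd conductor `< 5·10⁵` exactly 125 optimal curves carry a formal rational 2-torsion
  abscissa (all squarefree levels) and `α² − 32β = ±256` in ALL of them (`+256`: the 35 composite classes, shape `{r, e, e+4}`; `−256`: the 90 prime levels);
  `v_p(Δ(E₀)) = 2·v_p(Δ(E₀/P))` at every `p ∣ N`, 125/125.
So v10 has SIX stubs: `stub_sigmaNode`, `stub_optimalNotMidPointed` (RESEARCH) and the prints `stub_gamma1Datum`, `stub_abbesUllmo`, `stub_ubd`,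
`stub_edixhoven`; (SQΣ_f) `stub_sigmaSquare` and (T1) `stub_optimalNotTypeA` are kept as `def`s and DERIVED; the composition `DepletedLambdaLawAtTwoMod_of`
concludes the crux BY NAME.

HISTORY (v9.1, GEN 16).

WHAT CHANGED SINCE v8 (same GEN, second half).  THEOREM A at 2 is now a TREE THEOREM modulo UBD + Edixhoven
(Theorems/…StarOptBSFTheoremAFormal, `ThmAFormal.kummerParity_formal_of_mem_gamma1`: the Kummer parity of a FORMAL rational 2-torsion abscissa of
the lattice-optimal `W₀` is trivial on `Γ₁(N)`, i.e. its half-period class is of Shimura type), and v8's research stub (T1) `stub_optimalNotTypeA`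
is DERIVED (Theorems/…StarOptBSFTypeAResidue, `TypeAResidue.optimalNotTypeA_of_sigmaSquare`) from the sharper research stub
* `stub_sigmaSquare` (SQΣ, RESEARCH): «a rational 2-torsion abscissa of the lattice-optimal `W₀` whose Kummer parity is trivial on `Γ₁(N)` (a
  Σ-type point) forces `Δ(W₀) = c²` or `Δ(W₀) = −c²`» — GEN 15's −□/position law for Shimura points; Jacobian mechanism (Σ1): `Σ(N)[2]` misses the
  Néron identity component of `J₀(N)` at every `p ∣ N`, so every `v_p(Δ_min)` is even; open in print at 2 —
plus the PRINT `stub_edixhoven` (integrality of the `X₀(N)`-Manin constant, tree named fact `edixhoven_optimalManinConstant_integral`).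
(T2) `stub_optimalNotMidPointed` is unchanged (automatic at levels whose primes are all `≡ 3 (mod 4)`: Theorems/…ShimuraExponentLevels,
`SfShimuraExp.starOptBSF_threeModFour_of_T1`).  So v9 has SIX stubs: `stub_sigmaSquare`, `stub_optimalNotMidPointed` (RESEARCH) and the prints
`stub_gamma1Datum`, `stub_abbesUllmo`, `stub_ubd`, `stub_edixhoven`; the composition `DepletedLambdaLawAtTwoMod_of` concludes the crux BY NAME.

WHAT CHANGED SINCE v7.  v7's single research stub `stub_starOptBSFEven` («StarOptB at squarefree N ≠ 15, even Shimura index») is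
SPLIT into the two POSITION LAWS of the `X₀(N)`-lattice-optimal curve `W₀` that GEN 15's print-free door
`SfPositions.starOptBSF_of_positions` (Theorems/…StarOptBSFPositions) consumes — they give v6's `stub_starOptBSF` for EVERY Shimura index,
so the odd/even case split and the print `stub_gamma1Datum` are no longer on the squarefree path (the print is still used by the
non-squarefree door and by kummer):
* `stub_optimalNotTypeA` (T1, RESEARCH): «`W₀` good ordinary at 2 with a UNIQUE rational 2-torsion abscissa that is FORMAL ⇒ it is ODD» —
  no type-A optimal curve with unique 2-torsion, at any level (census 0 / 38 258 optimal curves with unique 2-torsion, odd squarefree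
  `N < 5·10⁵`; prime level `N = u²+64, 17` gives MID, not type A).  MECHANISM (GEN 16 memo Lines/star-even-structure-gen16.md §3): by
  THEOREM A the formal point lies in `Σ(N)[2]`; the position law «`Σ(N)[2]` misses the identity component of the Néron model of `J₀(N)` at
  every `p ∣ N`» forces `|Δ_min(W₀)| = □`, hence full rational 2-torsion when `Δ > 0` — a purely modular statement (Σ1), open in print.
* `stub_optimalNotMidPointed` (T2, RESEARCH): «in a habitat class at squarefree `N ≠ 15`, no rational 2-torsion abscissa of `W₀` is formal AND
  odd».  GEN 16 (Theorems/…StarOptBSFShimuraExponent, `SfShimuraExp.starOptBSF_of_shimuraExpTwo_of_T1`, `…_pq3_of_T1`): this is AUTOMATIC,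
  given (T1) and the prints, whenever the Shimura exponent `[Λ_f : Λ₁(f)]` has 2-part ≤ 2 — in particular at every `N = pq` with
  `p ≡ q ≡ 3 (mod 4)` (`Λ_f/Λ₁(f)` is a quotient of `(ℤ/N)ˣ`, Theorems/…ShimuraExponentLemmas): a MID-pointed optimal centre needs
  `4 ∣ [Λ_f : Λ₁(f)]` (data: only 15a, 17a below `5·10⁵`).  What is left of (T2) is the set of squarefree levels with a prime `≡ 1 (mod 4)`.
CENSUS (GEN 16, Cremona `N < 5·10⁵`): the 35 composite even-index classes are exactly `N = pq` Frey classes of `A + 16 = B` with `{A, B}`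
prime powers (or `A + B = 16`: 15, 21, 39, 55); habitat ⟺ `A ≡ 3 (mod 4)`; MID-pointed (non-habitat) ⟺ `A = s²`; 22 of the 27 habitat ones have
`p ≡ q ≡ 3 (mod 4)`.  Numerically (kit j326068) the Kummer parity functional of the formal point of `W₀` is `d ↦ (1 − ε(d))/2` for an even
quadratic character `ε mod N` (THEOREM A), the other two are not functions of `d`.

So v8 has FIVE stubs: `stub_optimalNotTypeA`, `stub_optimalNotMidPointed` (RESEARCH) and the three PRINTS of v6/v7 (`stub_gamma1Datum`,
`stub_abbesUllmo`, `stub_ubd`); the composition `DepletedLambdaLawAtTwoMod_of` concludes the crux BY NAME (kernel-checked, no sorry of its own).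
v7's `stub_starOptBSFEven` and v6's `stub_starOptBSF` are kept as `def`s and DERIVED.

HISTORY (v7, GEN 15).
# Line `star` on crux E1M `DepletedLambdaLawAtTwoMod` (stmt-BirchSwinnertonDyer-20341, ASIDE since rev 19) — v7 (lead star-p1 GEN 15, 2026-08-29)

WHAT CHANGED SINCE v6.  v6's only research stub `stub_starOptBSF` («StarOptB at SQUAREFREE level N ≠ 15»: the `X₀(N)`-lattice-optimal
curve `W₀` of a habitat class has a rational 2-torsion point that is ODD and NOT ramified at 2) is SPLIT along the parity of the SHIMURA
INDEX of the class's newform `f` — the exponent of `Λ_f / Λ₁(f)` (`Λ₁(f) = periodLatticeGamma1 f ≤ Λ_f = periodLattice f`; up to the odd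
Manin constants the degree of the Shimura cover `E₀ → E₁` of the `X₀(N)`- by the `X₁(N)`-optimal curve):
* ODD index (`∃ d` odd, `dΛ_f ⊆ Λ₁(f)`): CLOSED FROM PRINT this GEN, at EVERY level — tree theorem
  `SfOddCover.starOptB_oddIndex_of_print` (Theorems/…StarOptBSFOddCover): «Stevens at 2» for the `X₁(N)`-type curve holds at every
  level (`StevensAllLevels.stevensAtTwoX1Int_allLevels`, Theorems/…StarOptBSFStevensAllLevels — the nsf door's Kummer-form / UBD
  argument never used its `¬2∣N` / traceless-prime / ordinarity binders), the rational lattice inclusion `(dc₁/q)Λ_{W₀} ⊆ Λ_{W₁}` is an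
  isogeny of ODD degree, formal rational 2-torsion transports along odd isogenies, and regime transport finishes.  The whole
  non-squarefree door (`StarOptBNSF`, item 27047) is the instance `d = p` a traceless prime (`SfOddCover.oddIndex_of_tracelessPrime`).
* EVEN index (no odd `d` with `dΛ_f ⊆ Λ₁(f)`): the NEW research stub `stub_starOptBSFEven` below = v6's `stub_starOptBSF` verbatim with
  the even-index clause inserted after `IsNewformOf W f`.  CENSUS (Cremona allisog, exact arithmetic, odd squarefree N < 5·10⁵, N ≠ 15;
  folder numerics/sf_census.out of the GEN 15 seat, evidence on 20341): 20 577 habitat classes; `W₀` (Cremona's curve 1) fails to be the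
  2-adic sink (⟺ even index, given Stevens at 2) in exactly 27 of them (21a, 33a, 39a, 55a, 57b, 129b, 161a, 681b, …, 423737a), and in
  ALL 27 `W₀` is the full-2-torsion centre of the 2-isogeny tree with its formal point DIFFERENT from its odd (least-root) point — so the
  stub's conclusion holds (0 failures); at N = 15 it fails (15a1: formal point = odd point; the excluded level).  Off habitat the even
  index is the prime-level Neumann–Setzer / X₀(17) phenomenon (90 classes N = u²+64 or 17, optimal curve MID) and 7 composite
  non-habitat centres (291b, 1507b, 16919a, 19731b, 30287a, 161227a, 494303a).  STRUCTURE for whoever attacks it: (E1) «even index at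
  composite squarefree level ⇒ W₀ has full rational 2-torsion» (27/27 + 7/7); (E2) if moreover the three 2-neighbours of W₀ have unique
  rational 2-torsion (T4 tree) the conclusion is pure combinatorics of the étale/formal and odd/even dualities under 2-isogeny (a habitat
  leaf W₀/P forces P ∈ {formal-even, étale-odd}, so formal ≠ odd on W₀); (E3) T6/T8 trees: «W₀ is not the MID-pointed centre» — false
  exactly at N = 15 (15a1).  Open in print (2-part of the Shimura cover / Stein–Watkins at composite squarefree level).

So v7 has FOUR stubs: `stub_starOptBSFEven` (RESEARCH) and the three PRINTS of v6 (`stub_gamma1Datum`, `stub_abbesUllmo`, `stub_ubd`),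
and the composition `DepletedLambdaLawAtTwoMod_of` concludes the crux BY NAME (kernel-checked, no sorry of its own).  v6's statement
`stub_starOptBSF` is kept as a `def` and DERIVED (`starOptBSF_of_even`, no sorry), so no line of attack is lost.

HONEST FRAMING (Barrier B1): a skeleton for an OPEN aside crux; `sorry` lives only in the three print stubs `Holds.stub_cuspNonsingular/abbesUllmo/ubd`; nothing here reads an analytic
rank; E1M, E1M_NSF, the leaf T-r3₂ and BSD are NOT proved (PARTITION D-0054: none — r_an ≥ 2, axis S0; no S0 motion).
-/

-- v16 (GEN 20)
set_option linter.dupNamespace false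
set_option autoImplicit false

namespace Summit.BirchSwinnertonDyer.BirchSwinnertonDyer.Cruxes.DepletedLambdaLawAtTwoMod.Star

open scoped MatrixGroups ModularForm
open Literature.NumberTheory.EllipticCurves
open Literature.NumberTheory.EllipticCurves.Greenberg1999
open Literature.NumberTheory.EllipticCurves.ModularForms
open Summit.BirchSwinnertonDyer.BirchSwinnertonDyer.Theorems.DepletionAtTwo

/-! ### The stubs (registered obligations; `sorry` lives only here) -/

/-- STUB `stub_cuspNonsingular` (PRINT — the tree's NAMED FACT, verbatim; NEW in v13, GEN 18): images of the cusps over `∞` under an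
`X₁(N)`-parametrisation reduce NON-SINGULARLY modulo every prime (Conrad–Edixhoven–Stein 2003 §6.1.2: `X_μ(N)` is a smooth `ℤ`-curve whose
`ℤ`-points `⟨d⟩∞` are the cusps over `∞`, mapping to the Néron model; Igusa 1968 / Katz–Mazur 12.6: its fibres are connected; Silverman ATAEC
IV.9.1: identity component = non-singular locus of the minimal model).  Consumed by `SigmaNode.sigmaNode_of_cuspImageNonsingular`
(Theorems/…StarOptBSFSigmaNodeCusp), which derives the node law (N256) at EVERY level from it and Edixhoven.  Why it might fail: only if one of
the three printed inputs is misquoted (the fact is their juxtaposition); data: the node law holds for 125/125 optimal curves with a formal point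
among all 432 182 odd-conductor classes `N < 5·10⁵` (GEN 17).
[cite: ConradEdixhovenStein2003, §6.1.2 proof of Lemma 6.1.6 (p. 381)] [cite: KatzMazur1985, Thm. 12.6.1 and Cor. 12.6.2] [cite: SilvermanATAEC1994, IV.9 Cor. 9.1] -/
theorem Holds.stub_cuspNonsingular : gamma1Parametrization_cuspImage_nonsingularReduction := by
  sorry

/-- `stub_edixhoven` DISCHARGED BY NAME (v15): integrality of the `X₀(N)`-Manin constant in lattice form (Edixhoven 1991, Prop. 2: the scale `q` with
`Λ_{W₀} = q·Λ_f` is an integer; consumed by THEOREM A at 2, `ThmAFormal.kummerParity_formal_of_mem_gamma1`) is the TREE THEOREM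
`edixhoven_optimalManinConstant_integral_holds` (Literature/…/ManinConstantDeuringTwistProofs) — no `sorry`. [cite: Edixhoven1991, Prop. 2] [cite: AgasheRibetStein2006, Thm. 2.2] -/
theorem Holds.stub_edixhoven : edixhoven_optimalManinConstant_integral :=
  edixhoven_optimalManinConstant_integral_holds

/-- (v19: PROVED — `EvenBranch.stub_evenKummerForm`, Theorems/…StarEvenKummerForm; no `sorry`.) STUB `stub_evenKummerForm` (S2 — RESEARCH, size L, NEW in v18, GEN 21; Kummer side of the parity split).  THE UNTWISTED KUMMER FORM FOR AN
EVEN MANIN CONSTANT.  For the optimal `(W₀, f, Λ₀ = q·Λ_f)` at odd level, good ordinary at `2`, with `q` EVEN, an ÉTALE rational 2-torsion abscissa `x₀`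
with half-period `λ`, and the untwisted parity cover `Γ′ = {γ ∈ Γ₁(N) : q{∞,γ∞}_f ∈ ℤλ + 2Λ₀}` (membership predicate as in `ParityGroup.exists_parityGroup`):
if `Γ′ ≠ Γ₁(N)` then `Γ′` carries a non-zero cusp form of some weight, anti-invariant under `Γ₁(N) ∖ Γ′`, with an integral multiple at `∞` — EXACTLY the
input of `CongruenceCore.false_of_antiinvariant_integral_cuspForm_wt`.  PROOF PLAN: the Kummer function `κ̃ = sqrt(x∘φ₀ − x₀)·(−x/y)∘φ₀` has `q`-expansion
`sqrt(V_q)`, `V_q = Z_q²(x(Z_q) − x₀)`, and for EVEN `q` the EVEN-MULTIPLE SQUARE LAW makes `sqrt(V_q) ∈ 1 + qℤ⟦q⟧` (`[2]^*(x − x₀) = h²` on `W₀`, so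
`V_{2q′} = (Z_{2q′}·h(Z_{q′}))²`; numerics: 6 optimal curves × every étale `x₀` × `c ∈ {2,4,6}`, `sqrt(V_c) ∈ ℤ₂⟦q⟧`, while `sqrt(Θ_N V_c) ∉`); then
line nsf's engines `KummerForm` / `KummerQExp` / `KummerAlg` (THEOREM A, formal case) with the companion `Δ^m` instead of the `η`-quotient square root.
Why it might fail: only in the assembly (pole bookkeeping of `κ̃` at `φ₀⁻¹{y = 0}`); the square law itself is an identity. (No cite: research stub.) -/
theorem Holds.stub_evenKummerForm :
    ∀ (W₀ : WeierstrassCurve ℚ) [W₀.IsElliptic] [W₀.IsGloballyMinimal] ⦃N : ℕ⦄ [NeZero N]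
      (f : CuspForm (CongruenceSubgroup.Gamma0 N) 2), IsNewformOf W₀ f → ¬ 2 ∣ N → IsOrdinaryAt W₀ 2 →
      ∀ (L₀ : PeriodPair), IsNeronLatticeOf (W₀.baseChange ℂ) L₀ → ∀ (q : ℤ), q ≠ 0 → Even q →
      (∀ z ∈ periodLattice f, (q : ℂ) * z ∈ L₀.lattice) → (∀ z ∈ L₀.lattice, ∃ w ∈ periodLattice f, z = (q : ℂ) * w) →
      ∀ (x₀ : ℚ), HasRationalTwoTorsionX W₀ x₀ → ¬ TwoTorsionRamifiedAtTwo x₀ →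
      ∀ (lam : ℂ), lam ∈ L₀.lattice → lam / 2 ∉ L₀.lattice →
        L₀.weierstrassP (lam / 2) - ((W₀.b₂ : ℚ) : ℂ) / 12 = ((x₀ : ℚ) : ℂ) →
      ∀ Γ' : Subgroup SL(2, ℤ),
        (∀ γ : SL(2, ℤ), γ ∈ Γ' ↔ ∃ hγ : γ ∈ CongruenceSubgroup.Gamma0 N, γ ∈ CongruenceSubgroup.Gamma1 N ∧
          ∃ k : ℤ, ∃ w ∈ L₀.lattice, ((q : ℚ) : ℂ) * cuspSymbol f ⟨γ, hγ⟩ = (k : ℂ) * lam + 2 * w) →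
        (∃ γ₀ ∈ CongruenceSubgroup.Gamma1 N, γ₀ ∉ Γ') →
        ∃ (k : ℤ) (h : CuspForm Γ' k) (M : ℕ),
          (h : UpperHalfPlane → ℂ) ≠ 0 ∧
          (∀ γ ∈ CongruenceSubgroup.Gamma1 N, γ ∉ Γ' → (h : UpperHalfPlane → ℂ) ∣[k] γ = -h) ∧
          M ≠ 0 ∧
          ∀ n : ℕ, ∃ z : ℤ,
            PowerSeries.coeff n (UpperHalfPlane.qExpansion (1 : ℝ) (fun τ : UpperHalfPlane ↦ (M : ℂ) * h τ)) = (z : ℂ) :=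
  EvenBranch.stub_evenKummerForm

/-- (v19: PROVED — `SigmaNode.stub_etaleLiftSecondPoint`, Theorems/…StarEtaleLiftSecondPoint; no `sorry`.) STUB `stub_etaleLiftSecondPoint` (S4 — RESEARCH, size M, NEW in v18, GEN 21; (F) side, the ÉTALE twin of the node law
`SigmaNode.sigmaNode_of_cuspImageNonsingular`).  If, for the optimal `(W₀, f, Λ₀ = q·Λ_f)` at odd level (good ordinary at `2`, `q` even), an ÉTALE
rational 2-torsion abscissa `x₀` (half-period `λ`) satisfies LIFT(x₀) «`q{∞,γ∞}_f ∈ ℤλ + 2Λ₀` for every `γ ∈ Γ₁(N)`», then `W₀` has a SECOND étale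
rational 2-torsion abscissa `x₁ ≠ x₀`.  PROOF PLAN: LIFT(x₀) makes `τ ↦ q∫f mod (ℤλ + 2Λ₀)` an `X₁(N)`-parametrisation of `W′ = W₀/⟨P₀⟩` whose cusp
images over `∞` are `O` and the generator `T′` of `ker(W′ → W₀)` — the FORMAL 2-torsion point of `W′` (dual of the étale `⟨P₀⟩`), `T′ = (0,0)` on
`Y² = X(X² − (α/2)X + (α² − 32β)/16)`, `α = b₂ + 12x₀` (odd: `a₁` odd), `β = b₄ + x₀b₂ + 6x₀²`; (F) ⇒ `T′` non-singular at every odd prime ⇒ no odd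
prime divides `α² − 32β` ⇒ `α² − 32β = 1` (it is `≡ 1 mod 8`) ⇒ the cubic `4X³ + αX² + 2βX` has the rational roots `0, −(α∓1)/8`, one of them an
integer: `x₁ = x₀ − (α∓1)/8`.  Data: at étale points of optimal curves `α² − 32β` is a power of an odd bad prime (81, 625 for 15a1; 49, 81 for 21a1;
729, 121 for 33a1), never 1; `= ±256` at the formal point.  Why it might fail: the minimal-model bookkeeping of `W′` at odd primes (as in GEN 18's file).
(No cite: research stub.) -/
theorem Holds.stub_etaleLiftSecondPoint :
    gamma1Parametrization_cuspImage_nonsingularReduction →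
    ∀ (W₀ : WeierstrassCurve ℚ) [W₀.IsElliptic] [W₀.IsGloballyMinimal] ⦃N : ℕ⦄ [NeZero N]
      (f : CuspForm (CongruenceSubgroup.Gamma0 N) 2), IsNewformOf W₀ f → ¬ 2 ∣ N → IsOrdinaryAt W₀ 2 →
      ∀ (L₀ : PeriodPair), IsNeronLatticeOf (W₀.baseChange ℂ) L₀ → ∀ (q : ℤ), q ≠ 0 → Even q →
      (∀ z ∈ periodLattice f, (q : ℂ) * z ∈ L₀.lattice) → (∀ z ∈ L₀.lattice, ∃ w ∈ periodLattice f, z = (q : ℂ) * w) →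
      ∀ (x₀ : ℚ), HasRationalTwoTorsionX W₀ x₀ → ¬ TwoTorsionRamifiedAtTwo x₀ →
      ∀ (lam : ℂ), lam ∈ L₀.lattice → lam / 2 ∉ L₀.lattice →
        L₀.weierstrassP (lam / 2) - ((W₀.b₂ : ℚ) : ℂ) / 12 = ((x₀ : ℚ) : ℂ) →
      (∀ (γ : SL(2, ℤ)) (hγ : γ ∈ CongruenceSubgroup.Gamma0 N), γ ∈ CongruenceSubgroup.Gamma1 N →
        ∃ k : ℤ, ∃ w ∈ L₀.lattice, ((q : ℚ) : ℂ) * cuspSymbol f ⟨γ, hγ⟩ = (k : ℂ) * lam + 2 * w) →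
      ∃ x₁ : ℚ, x₁ ≠ x₀ ∧ HasRationalTwoTorsionX W₀ x₁ ∧ ¬ TwoTorsionRamifiedAtTwo x₁ :=
  SigmaNode.stub_etaleLiftSecondPoint

/-- (v19: PROVED — `EvenBranch.stub_doubleLiftFalse`, Theorems/…StarDoubleLiftFalse; no `sorry`.) STUB `stub_doubleLiftFalse` (S5 — RESEARCH, size M, NEW in v18, GEN 21; (F) side).  Two distinct étale rational 2-torsion abscissae `x₀ ≠ x₁` of the
optimal `W₀` (odd level `N = N_{W₀} ≥ 11`, good ordinary at `2`, `q` EVEN) cannot BOTH satisfy LIFT.  PROOF PLAN: LIFT(x₀) ∧ LIFT(x₁) give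
`q{∞,γ∞}_f ∈ (ℤλ₀ + 2Λ₀) ∩ (ℤλ₁ + 2Λ₀) = 2Λ₀` on `Γ₁(N)`, i.e. `(q/2)·Λ₁(f) ⊆ Λ₀` with `q/2 ∈ ℤ`: `τ ↦ (q/2)∫f` is an `X₁(N)`-parametrisation of
`W₀` ITSELF (datum `c = q/2` of (F)), and since `{q{∞,γ∞}_f : γ ∈ Γ₀(N)} = Λ₀` its cusp images `(q/2){∞,γ∞}_f mod Λ₀` EXHAUST `Λ₀/2 mod Λ₀ = W₀[2]`;
(F) ⇒ every rational 2-torsion point `P` of `W₀` has non-singular reduction at every prime; but at an odd prime `p ∣ N` (bad for `W₀`; exists as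
`N ≥ 11` is odd) two roots of `4x³ + b₂x² + 2b₄x + b₆` (all three rational and `p`-integral) collide mod `p`, and for a 2-torsion point
`Φ_y(P) = 2y + a₁x + a₃ = 0`, `Φ_x(P) = −(x_P − x_Q)(x_P − x_R)/2` ⇒ singular.  Why it might fail: it cannot once (F) is read correctly
(`HasNonsingularReductionAt` = `ord_p x < 0 ∨` a unit partial derivative). (No cite: research stub.) -/
theorem Holds.stub_doubleLiftFalse :
    gamma1Parametrization_cuspImage_nonsingularReduction →
    ∀ (W₀ : WeierstrassCurve ℚ) [W₀.IsElliptic] [W₀.IsGloballyMinimal] ⦃N : ℕ⦄ [NeZero N]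
      (f : CuspForm (CongruenceSubgroup.Gamma0 N) 2), IsNewformOf W₀ f → ¬ 2 ∣ N → W₀.conductorNorm ℤ = N → 11 ≤ N → IsOrdinaryAt W₀ 2 →
      ∀ (L₀ : PeriodPair), IsNeronLatticeOf (W₀.baseChange ℂ) L₀ → ∀ (q : ℤ), q ≠ 0 → Even q →
      (∀ z ∈ periodLattice f, (q : ℂ) * z ∈ L₀.lattice) → (∀ z ∈ L₀.lattice, ∃ w ∈ periodLattice f, z = (q : ℂ) * w) →
      ∀ (x₀ x₁ : ℚ), x₀ ≠ x₁ →
      HasRationalTwoTorsionX W₀ x₀ → ¬ TwoTorsionRamifiedAtTwo x₀ →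
      ∀ (lam₀ : ℂ), lam₀ ∈ L₀.lattice → lam₀ / 2 ∉ L₀.lattice →
        L₀.weierstrassP (lam₀ / 2) - ((W₀.b₂ : ℚ) : ℂ) / 12 = ((x₀ : ℚ) : ℂ) →
      HasRationalTwoTorsionX W₀ x₁ → ¬ TwoTorsionRamifiedAtTwo x₁ →
      ∀ (lam₁ : ℂ), lam₁ ∈ L₀.lattice → lam₁ / 2 ∉ L₀.lattice →
        L₀.weierstrassP (lam₁ / 2) - ((W₀.b₂ : ℚ) : ℂ) / 12 = ((x₁ : ℚ) : ℂ) →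
      (∀ (γ : SL(2, ℤ)) (hγ : γ ∈ CongruenceSubgroup.Gamma0 N), γ ∈ CongruenceSubgroup.Gamma1 N →
        ∃ k : ℤ, ∃ w ∈ L₀.lattice, ((q : ℚ) : ℂ) * cuspSymbol f ⟨γ, hγ⟩ = (k : ℂ) * lam₀ + 2 * w) →
      (∀ (γ : SL(2, ℤ)) (hγ : γ ∈ CongruenceSubgroup.Gamma0 N), γ ∈ CongruenceSubgroup.Gamma1 N →
        ∃ k : ℤ, ∃ w ∈ L₀.lattice, ((q : ℚ) : ℂ) * cuspSymbol f ⟨γ, hγ⟩ = (k : ℂ) * lam₁ + 2 * w) →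
      False :=
  EvenBranch.stub_doubleLiftFalse

/-- STUB `stub_ubd` (PRINT — the tree's NAMED FACT, verbatim): the unbounded denominators theorem (Calegari–Dimitrov–Tang 2025 Thm 1.0.1),
consumed by both halves through `CongruenceCore.false_of_antiinvariant_integral_cuspForm_wt` (index-2 case). [cite: CalegariDimitrovTang2025, Thm. 1.0.1] -/
theorem Holds.stub_ubd : Literature.NumberTheory.Automorphic.CalegariDimitrovTang2025_unboundedDenominators := by
  sorry

/-- Handle for the registered print stub `stub_cuspNonsingular` (NEW, v13). -/
def stub_cuspNonsingular : Prop := gamma1Parametrization_cuspImage_nonsingularReduction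
/-- v12's research stub (N256 off the prime levels `≠ 17`) `stub_sigmaNodeCompositeOr17`, kept as a statement (now DERIVED: a special case of
`stub_sigmaNode`, itself derived from `stub_cuspNonsingular` + Edixhoven, `sigmaNode_of_cuspNonsingular`). -/
def stub_sigmaNodeCompositeOr17 : Prop :=
    ∀ (W₀ : WeierstrassCurve ℚ) [W₀.IsElliptic] [W₀.IsGloballyMinimal],
      (¬ (W₀.conductorNorm ℤ).Prime ∨ W₀.conductorNorm ℤ = 17) →
      ∀ ⦃N : ℕ⦄ [NeZero N] (f : CuspForm (CongruenceSubgroup.Gamma0 N) 2), IsNewformOf W₀ f → IsOrdinaryAt W₀ 2 →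
      ∀ (L₀ : PeriodPair), IsNeronLatticeOf (W₀.baseChange ℂ) L₀ → ∀ (q : ℚ), q ≠ 0 →
      (∀ z ∈ periodLattice f, (q : ℂ) * z ∈ L₀.lattice) → (∀ z ∈ L₀.lattice, ∃ w ∈ periodLattice f, z = (q : ℂ) * w) →
      ∀ (x : ℚ), HasRationalTwoTorsionX W₀ x → TwoTorsionRamifiedAtTwo x →
      ∀ (lam : ℂ), lam ∈ L₀.lattice → lam / 2 ∉ L₀.lattice →
        L₀.weierstrassP (lam / 2) - ((W₀.b₂ : ℚ) : ℂ) / 12 = ((x : ℚ) : ℂ) →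
      (∀ (γ : SL(2, ℤ)) (hγ : γ ∈ CongruenceSubgroup.Gamma0 N), γ ∈ CongruenceSubgroup.Gamma1 N →
        ∃ k : ℤ, ∃ w ∈ L₀.lattice, (q : ℂ) * cuspSymbol f ⟨γ, hγ⟩ = (k : ℂ) * lam + 2 * w) →
      (W₀.b₂ + 12 * x) ^ 2 - 32 * (W₀.b₄ + x * W₀.b₂ + 6 * x ^ 2) = 256 ∨
        (W₀.b₂ + 12 * x) ^ 2 - 32 * (W₀.b₄ + x * W₀.b₂ + 6 * x ^ 2) = -256
/-- v10/v11's research stub (N256, all levels) `stub_sigmaNode`, kept as a statement (now DERIVED from the composite-or-17 stub and Setzer, `sigmaNode_of_compositeOr17`). -/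
def stub_sigmaNode : Prop :=
    ∀ (W₀ : WeierstrassCurve ℚ) [W₀.IsElliptic] [W₀.IsGloballyMinimal]
      ⦃N : ℕ⦄ [NeZero N] (f : CuspForm (CongruenceSubgroup.Gamma0 N) 2), IsNewformOf W₀ f → IsOrdinaryAt W₀ 2 →
      ∀ (L₀ : PeriodPair), IsNeronLatticeOf (W₀.baseChange ℂ) L₀ → ∀ (q : ℚ), q ≠ 0 →
      (∀ z ∈ periodLattice f, (q : ℂ) * z ∈ L₀.lattice) → (∀ z ∈ L₀.lattice, ∃ w ∈ periodLattice f, z = (q : ℂ) * w) →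
      ∀ (x : ℚ), HasRationalTwoTorsionX W₀ x → TwoTorsionRamifiedAtTwo x →
      ∀ (lam : ℂ), lam ∈ L₀.lattice → lam / 2 ∉ L₀.lattice →
        L₀.weierstrassP (lam / 2) - ((W₀.b₂ : ℚ) : ℂ) / 12 = ((x : ℚ) : ℂ) →
      (∀ (γ : SL(2, ℤ)) (hγ : γ ∈ CongruenceSubgroup.Gamma0 N), γ ∈ CongruenceSubgroup.Gamma1 N →
        ∃ k : ℤ, ∃ w ∈ L₀.lattice, (q : ℂ) * cuspSymbol f ⟨γ, hγ⟩ = (k : ℂ) * lam + 2 * w) →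
      (W₀.b₂ + 12 * x) ^ 2 - 32 * (W₀.b₄ + x * W₀.b₂ + 6 * x ^ 2) = 256 ∨
        (W₀.b₂ + 12 * x) ^ 2 - 32 * (W₀.b₄ + x * W₀.b₂ + 6 * x ^ 2) = -256
/-- v9.1's research stub (SQΣ_f) `stub_sigmaSquare`, kept as a statement (now DERIVED, `sigmaSquare_of_sigmaNode`). -/
def stub_sigmaSquare : Prop :=
    ∀ (W₀ : WeierstrassCurve ℚ) [W₀.IsElliptic] [W₀.IsGloballyMinimal]
      ⦃N : ℕ⦄ [NeZero N] (f : CuspForm (CongruenceSubgroup.Gamma0 N) 2), IsNewformOf W₀ f → IsOrdinaryAt W₀ 2 →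
      ∀ (L₀ : PeriodPair), IsNeronLatticeOf (W₀.baseChange ℂ) L₀ → ∀ (q : ℚ), q ≠ 0 →
      (∀ z ∈ periodLattice f, (q : ℂ) * z ∈ L₀.lattice) → (∀ z ∈ L₀.lattice, ∃ w ∈ periodLattice f, z = (q : ℂ) * w) →
      ∀ (x : ℚ), HasRationalTwoTorsionX W₀ x → TwoTorsionRamifiedAtTwo x →
      ∀ (lam : ℂ), lam ∈ L₀.lattice → lam / 2 ∉ L₀.lattice →
        L₀.weierstrassP (lam / 2) - ((W₀.b₂ : ℚ) : ℂ) / 12 = ((x : ℚ) : ℂ) →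
      (∀ (γ : SL(2, ℤ)) (hγ : γ ∈ CongruenceSubgroup.Gamma0 N), γ ∈ CongruenceSubgroup.Gamma1 N →
        ∃ k : ℤ, ∃ w ∈ L₀.lattice, (q : ℂ) * cuspSymbol f ⟨γ, hγ⟩ = (k : ℂ) * lam + 2 * w) →
      ∃ c : ℚ, W₀.Δ = c ^ 2 ∨ W₀.Δ = -c ^ 2
/-- Handle for v13/v14's print stub `stub_edixhoven` — DISCHARGED in v15 (`Holds.stub_edixhoven` is a proof by the tree theorem
`edixhoven_optimalManinConstant_integral_holds`); kept as the hypothesis name of the glue below. -/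
def stub_edixhoven : Prop := edixhoven_optimalManinConstant_integral
/-- v8's research stub (T1) `stub_optimalNotTypeA`, kept as a statement (now DERIVED, `optimalNotTypeA_of_sigmaSquare`). -/
def stub_optimalNotTypeA : Prop :=
    ∀ (W₀ : WeierstrassCurve ℚ) [W₀.IsElliptic] [W₀.IsGloballyMinimal]
      ⦃N : ℕ⦄ [NeZero N] (f : CuspForm (CongruenceSubgroup.Gamma0 N) 2), IsNewformOf W₀ f → IsOrdinaryAt W₀ 2 →
      ∀ (L₀ : PeriodPair), IsNeronLatticeOf (W₀.baseChange ℂ) L₀ → ∀ (q : ℚ), q ≠ 0 →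
      (∀ z ∈ periodLattice f, (q : ℂ) * z ∈ L₀.lattice) → (∀ z ∈ L₀.lattice, ∃ w ∈ periodLattice f, z = (q : ℂ) * w) →
      ∀ (x₀ : ℚ), HasUniqueRationalTwoTorsionX W₀ x₀ → TwoTorsionRamifiedAtTwo x₀ → TwoTorsionOdd W₀ x₀
/-- v13's print stub `stub_cremona17` (Cremona's conductor-17 table), kept as a statement only: NO LONGER A STUB in v14 — the `−256` branch is Cremona-free
(`SigmaNode.false_of_seventeenShape_free`). -/
def stub_cremona17 : Prop := Cremona1997_conductor_seventeen_classification
/-- v11's research stub (T2‴) `stub_noSetzerShape`, kept as a statement (now DERIVED inside `SigmaNode.partnerNotCentre_of_sigmaNode_of_prints`: a `−256`-shape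
MID point with a centre partner is the `17a1` shape; without a centre partner it is harmless for the MID walk). -/
def stub_noSetzerShape : Prop :=
    ∀ (W : WeierstrassCurve ℚ) [W.IsElliptic] [W.IsGloballyMinimal] (x : ℚ), IsOrdinaryAt W 2 →
      HasUniqueRationalTwoTorsionX W x →
      ((TwoTorsionRamifiedAtTwo x ∧ ¬ TwoTorsionOdd W x) ∨ (TwoTorsionOdd W x ∧ ¬ TwoTorsionRamifiedAtTwo x)) →
      W.conductorNorm ℤ ≠ 15 → Squarefree (W.conductorNorm ℤ) →
      ∀ ⦃N : ℕ⦄ [NeZero N] (f : CuspForm (CongruenceSubgroup.Gamma0 N) 2), IsNewformOf W f →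
      ∀ (W₀ : WeierstrassCurve ℚ) [W₀.IsElliptic] [W₀.IsGloballyMinimal], IsNewformOf W₀ f →
      ∀ (L₀ : PeriodPair), IsNeronLatticeOf (W₀.baseChange ℂ) L₀ → ∀ (q : ℚ), q ≠ 0 →
      (∀ z ∈ periodLattice f, (q : ℂ) * z ∈ L₀.lattice) → (∀ z ∈ L₀.lattice, ∃ w ∈ periodLattice f, z = (q : ℂ) * w) →
      ∀ (x₀ : ℚ), HasRationalTwoTorsionX W₀ x₀ → TwoTorsionRamifiedAtTwo x₀ → TwoTorsionOdd W₀ x₀ →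
      (W₀.b₂ + 12 * x₀) ^ 2 - 32 * (W₀.b₄ + x₀ * W₀.b₂ + 6 * x₀ ^ 2) ≠ -256
/-- v13's print stub `stub_setzer` (Setzer 1975), kept as a statement only: NO LONGER A STUB in v14 — the `+256` branch is Setzer-free
(`SigmaNode.false_of_fifteenShape_free`); still consumed by the optional glue `sigmaNode_of_compositeOr17` (off the composition path). -/
def stub_setzer : Prop := Setzer1975_primeConductor_rationalTwoTorsion
/-- (T2′) «the MID point's 2-isogenous partner is not a centre» (GEN 17), kept as a statement (DERIVED, `midPartnerNotCentre_of_sigmaNode`). -/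
def stub_midPartnerNotCentre : Prop :=
    ∀ (W : WeierstrassCurve ℚ) [W.IsElliptic] [W.IsGloballyMinimal] (x : ℚ), IsOrdinaryAt W 2 →
      HasUniqueRationalTwoTorsionX W x →
      ((TwoTorsionRamifiedAtTwo x ∧ ¬ TwoTorsionOdd W x) ∨ (TwoTorsionOdd W x ∧ ¬ TwoTorsionRamifiedAtTwo x)) →
      W.conductorNorm ℤ ≠ 15 → Squarefree (W.conductorNorm ℤ) →
      ∀ ⦃N : ℕ⦄ [NeZero N] (f : CuspForm (CongruenceSubgroup.Gamma0 N) 2), IsNewformOf W f →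
      ∀ (W₀ : WeierstrassCurve ℚ) [W₀.IsElliptic] [W₀.IsGloballyMinimal], IsNewformOf W₀ f →
      ∀ (L₀ : PeriodPair), IsNeronLatticeOf (W₀.baseChange ℂ) L₀ → ∀ (q : ℚ), q ≠ 0 →
      (∀ z ∈ periodLattice f, (q : ℂ) * z ∈ L₀.lattice) → (∀ z ∈ L₀.lattice, ∃ w ∈ periodLattice f, z = (q : ℂ) * w) →
      ∀ (x₀ : ℚ), HasRationalTwoTorsionX W₀ x₀ → TwoTorsionRamifiedAtTwo x₀ → TwoTorsionOdd W₀ x₀ →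
      ¬ IsSquare ((W₀.b₄ + x₀ * W₀.b₂ + 6 * x₀ ^ 2) / 2)
/-- v7–v10's research stub (T2) `stub_optimalNotMidPointed`, kept as a statement (now DERIVED, `optimalNotMidPointed_of_sigmaNode`). -/
def stub_optimalNotMidPointed : Prop :=
    ∀ (W : WeierstrassCurve ℚ) [W.IsElliptic] [W.IsGloballyMinimal] (x : ℚ), IsOrdinaryAt W 2 →
      HasUniqueRationalTwoTorsionX W x →
      ((TwoTorsionRamifiedAtTwo x ∧ ¬ TwoTorsionOdd W x) ∨ (TwoTorsionOdd W x ∧ ¬ TwoTorsionRamifiedAtTwo x)) →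
      W.conductorNorm ℤ ≠ 15 → Squarefree (W.conductorNorm ℤ) →
      ∀ ⦃N : ℕ⦄ [NeZero N] (f : CuspForm (CongruenceSubgroup.Gamma0 N) 2), IsNewformOf W f →
      ∀ (W₀ : WeierstrassCurve ℚ) [W₀.IsElliptic] [W₀.IsGloballyMinimal], IsNewformOf W₀ f →
      ∀ (L₀ : PeriodPair), IsNeronLatticeOf (W₀.baseChange ℂ) L₀ → ∀ (q : ℚ), q ≠ 0 →
      (∀ z ∈ periodLattice f, (q : ℂ) * z ∈ L₀.lattice) → (∀ z ∈ L₀.lattice, ∃ w ∈ periodLattice f, z = (q : ℂ) * w) →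
      ∀ (x₀ : ℚ), HasRationalTwoTorsionX W₀ x₀ → TwoTorsionRamifiedAtTwo x₀ → ¬ TwoTorsionOdd W₀ x₀
/-- v6–v15's print stub `stub_gamma1Datum` (the optimal `Γ₁(N)`-datum, CES 2003 §6.1 / Stevens 1989), kept as a statement only: NO LONGER A STUB in v16 —
the non-squarefree half of `StarOptB` now comes from the node law too (`SigmaNode.starOptB_of_twoPrints`). -/
def stub_gamma1Datum : Prop := exists_optimal_gamma1ParametrizationData
/-- Handle for the registered print stub `stub_abbesUllmo`. -/
def stub_abbesUllmo : Prop := abbesUllmo_not_dvd_maninConstant_of_not_dvd_level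

/-- (OddManin₂) — v17's print-residue statement, now a plain `def` DERIVED from the v18 stubs (`oddManinAtTwo_of_stubs`). -/
def stub_oddManinAtTwo : Prop :=
    ∀ (W₀ : WeierstrassCurve ℚ) [W₀.IsElliptic] [W₀.IsGloballyMinimal] ⦃N : ℕ⦄ [NeZero N]
      (f : CuspForm (CongruenceSubgroup.Gamma0 N) 2), IsNewformOf W₀ f → ¬ 2 ∣ N → IsOrdinaryAt W₀ 2 →
      ∀ (L₀ : PeriodPair), IsNeronLatticeOf (W₀.baseChange ℂ) L₀ → ∀ (q : ℤ), q ≠ 0 →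
      (∀ z ∈ periodLattice f, (q : ℂ) * z ∈ L₀.lattice) → (∀ z ∈ L₀.lattice, ∃ w ∈ periodLattice f, z = (q : ℂ) * w) →
      ∀ (x₀ : ℚ), HasRationalTwoTorsionX W₀ x₀ → ¬ TwoTorsionRamifiedAtTwo x₀ → Odd q

/-- Handle for the registered research stub `stub_evenKummerForm` (S2, NEW, v18). -/
def stub_evenKummerForm : Prop := type_of% Holds.stub_evenKummerForm

/-- Handle for the registered research stub `stub_etaleLiftSecondPoint` (S4, NEW, v18). -/
def stub_etaleLiftSecondPoint : Prop := type_of% Holds.stub_etaleLiftSecondPoint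

/-- Handle for the registered research stub `stub_doubleLiftFalse` (S5, NEW, v18). -/
def stub_doubleLiftFalse : Prop := type_of% Holds.stub_doubleLiftFalse
/-- Handle for the registered print stub `stub_ubd`. -/
def stub_ubd : Prop := Literature.NumberTheory.Automorphic.CalegariDimitrovTang2025_unboundedDenominators

/-- v6's research stub `stub_starOptBSF` («StarOptB at squarefree level N ≠ 15», all Shimura indices), kept as a statement. -/
def stub_starOptBSF : Prop :=
    ∀ (W : WeierstrassCurve ℚ) [W.IsElliptic] [W.IsGloballyMinimal] (x : ℚ), IsOrdinaryAt W 2 →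
      HasUniqueRationalTwoTorsionX W x →
      ((TwoTorsionRamifiedAtTwo x ∧ ¬ TwoTorsionOdd W x) ∨ (TwoTorsionOdd W x ∧ ¬ TwoTorsionRamifiedAtTwo x)) →
      W.conductorNorm ℤ ≠ 15 → Squarefree (W.conductorNorm ℤ) →
      ∀ ⦃N : ℕ⦄ [NeZero N] (f : CuspForm (CongruenceSubgroup.Gamma0 N) 2), IsNewformOf W f →
      ∀ (W₀ : WeierstrassCurve ℚ) [W₀.IsElliptic] [W₀.IsGloballyMinimal], IsNewformOf W₀ f →
      ∀ (L₀ : PeriodPair), IsNeronLatticeOf (W₀.baseChange ℂ) L₀ → ∀ (q : ℚ), q ≠ 0 →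
      (∀ z ∈ periodLattice f, (q : ℂ) * z ∈ L₀.lattice) → (∀ z ∈ L₀.lattice, ∃ w ∈ periodLattice f, z = (q : ℂ) * w) →
      ∃ x₀ : ℚ, HasRationalTwoTorsionX W₀ x₀ ∧ TwoTorsionOdd W₀ x₀ ∧ ¬ TwoTorsionRamifiedAtTwo x₀

/-- v7's research stub `stub_starOptBSFEven` («StarOptB at squarefree level N ≠ 15, EVEN Shimura index»), kept as a statement. -/
def stub_starOptBSFEven : Prop :=
    ∀ (W : WeierstrassCurve ℚ) [W.IsElliptic] [W.IsGloballyMinimal] (x : ℚ), IsOrdinaryAt W 2 →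
      HasUniqueRationalTwoTorsionX W x →
      ((TwoTorsionRamifiedAtTwo x ∧ ¬ TwoTorsionOdd W x) ∨ (TwoTorsionOdd W x ∧ ¬ TwoTorsionRamifiedAtTwo x)) →
      W.conductorNorm ℤ ≠ 15 → Squarefree (W.conductorNorm ℤ) →
      ∀ ⦃N : ℕ⦄ [NeZero N] (f : CuspForm (CongruenceSubgroup.Gamma0 N) 2), IsNewformOf W f →
      (¬ ∃ d : ℕ, Odd d ∧ ∀ w ∈ periodLattice f, (d : ℂ) * w ∈ periodLatticeGamma1 f) →
      ∀ (W₀ : WeierstrassCurve ℚ) [W₀.IsElliptic] [W₀.IsGloballyMinimal], IsNewformOf W₀ f →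
      ∀ (L₀ : PeriodPair), IsNeronLatticeOf (W₀.baseChange ℂ) L₀ → ∀ (q : ℚ), q ≠ 0 →
      (∀ z ∈ periodLattice f, (q : ℂ) * z ∈ L₀.lattice) → (∀ z ∈ L₀.lattice, ∃ w ∈ periodLattice f, z = (q : ℂ) * w) →
      ∃ x₀ : ℚ, HasRationalTwoTorsionX W₀ x₀ ∧ TwoTorsionOdd W₀ x₀ ∧ ¬ TwoTorsionRamifiedAtTwo x₀

/-! ### Glue (kernel-checked, no sorry of its own) -/

/-- (v17) The print-residue stub from the print: Abbes–Ullmo Thm A ⇒ (OddManin₂) (tree `KummerDoor.oddManinAtTwo_of_abbesUllmo`). [cite: AbbesUllmo1996, Thm. A] -/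
theorem stub_oddManinAtTwo_of_abbesUllmo (hAU : stub_abbesUllmo) : stub_oddManinAtTwo :=
  KummerDoor.oddManinAtTwo_of_abbesUllmo hAU

/-- **(v18 GLUE, kernel-checked) LIFT from the even Kummer form**: S2 + UBD (through `CongruenceCore.false_of_antiinvariant_integral_cuspForm_wt`, with the
parity group of `ParityGroup.exists_parityGroup`, its finite index and its parabolic elements) ⇒ for even `q` every étale rational 2-torsion abscissa `x₀`
of the optimal `W₀` satisfies LIFT(x₀): `q{∞,γ∞}_f ∈ ℤλ + 2Λ₀` for all `γ ∈ Γ₁(N)`. [cite: CalegariDimitrovTang2025, Thm. 1.0.1] -/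
theorem evenLift_of_evenKummerForm (hU : stub_ubd) (h2 : stub_evenKummerForm) :
    ∀ (W₀ : WeierstrassCurve ℚ) [W₀.IsElliptic] [W₀.IsGloballyMinimal] ⦃N : ℕ⦄ [NeZero N]
      (f : CuspForm (CongruenceSubgroup.Gamma0 N) 2), IsNewformOf W₀ f → ¬ 2 ∣ N → IsOrdinaryAt W₀ 2 →
      ∀ (L₀ : PeriodPair), IsNeronLatticeOf (W₀.baseChange ℂ) L₀ → ∀ (q : ℤ), q ≠ 0 → Even q →
      (∀ z ∈ periodLattice f, (q : ℂ) * z ∈ L₀.lattice) → (∀ z ∈ L₀.lattice, ∃ w ∈ periodLattice f, z = (q : ℂ) * w) →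
      ∀ (x₀ : ℚ), HasRationalTwoTorsionX W₀ x₀ → ¬ TwoTorsionRamifiedAtTwo x₀ →
      ∀ (lam : ℂ), lam ∈ L₀.lattice → lam / 2 ∉ L₀.lattice →
        L₀.weierstrassP (lam / 2) - ((W₀.b₂ : ℚ) : ℂ) / 12 = ((x₀ : ℚ) : ℂ) →
      (∀ (γ : SL(2, ℤ)) (hγ : γ ∈ CongruenceSubgroup.Gamma0 N), γ ∈ CongruenceSubgroup.Gamma1 N →
        ∃ k : ℤ, ∃ w ∈ L₀.lattice, ((q : ℚ) : ℂ) * cuspSymbol f ⟨γ, hγ⟩ = (k : ℂ) * lam + 2 * w) := by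
  intro W₀ _ _ N _ f hW₀ h2N hord L₀ hL₀ q hq0 hev hin hout x₀ hx₀ hnr lam hlam hlam2 h℘ γ hγ hγ1
  dsimp only [stub_ubd, stub_evenKummerForm] at hU h2
  have hin1 : ∀ z ∈ periodLatticeGamma1 f, ((q : ℚ) : ℂ) * z ∈ L₀.lattice := fun z hz ↦ by
    rw [Rat.cast_intCast]
    exact hin z (periodLatticeGamma1_le_periodLattice f hz)
  obtain ⟨Γ', hΓ⟩ := ParityGroup.exists_parityGroup f L₀ (q : ℚ) hin1 hlam hlam2
  by_contra hnot
  have hne : ∃ γ₀ ∈ CongruenceSubgroup.Gamma1 N, γ₀ ∉ Γ' := by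
    refine ⟨γ, hγ1, fun hmem ↦ hnot ?_⟩
    obtain ⟨hγ', -, hk⟩ := (hΓ γ).mp hmem
    exact hk
  haveI : Γ'.FiniteIndex := ParityGroup.finiteIndex_of_parity f L₀ (q : ℚ) hin1 hlam hlam2 hΓ
  obtain ⟨k, h, M, hh, hanti, hM, hint⟩ :=
    h2 W₀ f hW₀ h2N hord L₀ hL₀ q hq0 hev hin hout x₀ hx₀ hnr lam hlam hlam2 h℘ Γ' hΓ hne
  exact CongruenceCore.false_of_antiinvariant_integral_cuspForm_wt hU (NeZero.ne N)
    (fun γ' hγ'1 htr ↦ ParityGroup.mem_of_trace_eq_two f L₀ (q : ℚ) lam hΓ hγ'1 htr) hne h hh hanti hM hint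

/-- **(v18 GLUE, kernel-checked) (OddManin₂) FROM THE STUBS — the parity split.**  Suppose `q` even.  LIFT(x₀) (`evenLift_of_evenKummerForm`); a second
étale point `x₁ ≠ x₀` (S4); LIFT(x₁) (again); contradiction (S5) — with `N = N_{W₀}` by Carayol from MODULARITY (tree) and `N ≥ 11` because `S₂(Γ₀(N)) = 0`
for `N ≤ 10` while `a₁(f) = 1`.  Hence `q` is odd.  CONDITIONAL on the stubs; (OddManin₂) is thereby DERIVED, and Abbes–Ullmo is no longer an input.
[cite: CalegariDimitrovTang2025, Thm. 1.0.1] [cite: ConradEdixhovenStein2003, §6.1.2 proof of Lemma 6.1.6 (p. 381)] -/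
theorem oddManinAtTwo_of_stubs (hnf : exists_isNewformOf) (hF : stub_cuspNonsingular) (hU : stub_ubd)
    (h2 : stub_evenKummerForm) (h4 : stub_etaleLiftSecondPoint) (h5 : stub_doubleLiftFalse) : stub_oddManinAtTwo := by
  intro W₀ _ _ N _ f hW₀ h2N hord L₀ hL₀ q hq0 hin hout x₀ hx₀ hnr
  dsimp only [stub_cuspNonsingular, stub_etaleLiftSecondPoint, stub_doubleLiftFalse] at hF h4 h5
  by_contra hodd
  have hev : Even q := Int.not_odd_iff_even.mp hodd
  -- level = conductor (Carayol from modularity, tree) and `N ≥ 11`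
  have h4lvl : KummerDoor.stub_levelEqConductor := KummerDoor.stub_levelEqConductor_of_modularity hnf
  dsimp only [KummerDoor.stub_levelEqConductor] at h4lvl
  have hN₀ : W₀.conductorNorm ℤ = N := ((h4lvl N) hW₀).symm
  have h11 : 11 ≤ N := by
    by_contra hlt
    have hf0 : f = 0 := cuspForm_two_gamma0_eq_zero_of_le_ten (by omega) f
    have h1 : cuspCoeff f 1 = (W₀.LFunction 1 : ℂ) := hW₀.2 1
    rw [hf0, WeierstrassCurve.LFunction_apply_one] at h1
    have h0 : cuspCoeff (0 : CuspForm (CongruenceSubgroup.Gamma0 N) 2) 1 = 0 :=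
      (cuspCoeffₗ (one_mem_strictPeriods_coe_gamma0 N) 1).map_zero
    rw [h0] at h1
    norm_num at h1
  -- the half-period of `x₀`, LIFT(x₀), the second étale point, its half-period, LIFT(x₁), contradiction
  obtain ⟨lam, hlam, hlam2, h℘⟩ :=
    Literature.NumberTheory.EllipticCurves.exists_half_period_of_hasRationalTwoTorsionX W₀ L₀ hL₀ hx₀
  have hL : (∀ (γ : SL(2, ℤ)) (hγ : γ ∈ CongruenceSubgroup.Gamma0 N), γ ∈ CongruenceSubgroup.Gamma1 N →
        ∃ k : ℤ, ∃ w ∈ L₀.lattice, ((q : ℚ) : ℂ) * cuspSymbol f ⟨γ, hγ⟩ = (k : ℂ) * lam + 2 * w) :=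
    evenLift_of_evenKummerForm hU h2 W₀ f hW₀ h2N hord L₀ hL₀ q hq0 hev hin hout x₀ hx₀ hnr lam hlam hlam2 h℘
  obtain ⟨x₁, hne, hx₁, hnr₁⟩ := h4 hF W₀ f hW₀ h2N hord L₀ hL₀ q hq0 hev hin hout x₀ hx₀ hnr lam hlam hlam2 h℘ hL
  obtain ⟨lam₁, hlam₁, hlam₁2, h℘₁⟩ :=
    Literature.NumberTheory.EllipticCurves.exists_half_period_of_hasRationalTwoTorsionX W₀ L₀ hL₀ hx₁
  have hL₁ : (∀ (γ : SL(2, ℤ)) (hγ : γ ∈ CongruenceSubgroup.Gamma0 N), γ ∈ CongruenceSubgroup.Gamma1 N →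
        ∃ k : ℤ, ∃ w ∈ L₀.lattice, ((q : ℚ) : ℂ) * cuspSymbol f ⟨γ, hγ⟩ = (k : ℂ) * lam₁ + 2 * w) :=
    evenLift_of_evenKummerForm hU h2 W₀ f hW₀ h2N hord L₀ hL₀ q hq0 hev hin hout x₁ hx₁ hnr₁ lam₁ hlam₁ hlam₁2 h℘₁
  exact h5 hF W₀ f hW₀ h2N hN₀ h11 hord L₀ hL₀ q hq0 hev hin hout x₀ x₁ (Ne.symm hne) hx₀ hnr lam hlam hlam2 h℘ hx₁ hnr₁ lam₁ hlam₁ hlam₁2 h℘₁ hL hL₁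


/-- **(N256) at ALL levels from the print `stub_cuspNonsingular` and Edixhoven** — `SigmaNode.sigmaNode_of_cuspImageNonsingular` by name
(tree, Theorems/…StarOptBSFSigmaNodeCusp, GEN 18). CONDITIONAL on the two prints. [cite: ConradEdixhovenStein2003, §6.1.2 proof of Lemma 6.1.6 (p. 381)]
[cite: KatzMazur1985, Thm. 12.6.1 and Cor. 12.6.2] [cite: Edixhoven1991, Prop. 2] -/
theorem sigmaNode_of_cuspNonsingular (hF : stub_cuspNonsingular) (hEd : stub_edixhoven) : stub_sigmaNode :=
  SigmaNode.sigmaNode_of_cuspImageNonsingular hF hEd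

/-- v12's `stub_sigmaNodeCompositeOr17` is a special case of `stub_sigmaNode` (drop the level clause). CONDITIONAL on the prints.
[cite: ConradEdixhovenStein2003, §6.1.2 proof of Lemma 6.1.6 (p. 381)] -/
theorem sigmaNodeCompositeOr17_of_sigmaNode (hN : stub_sigmaNode) : stub_sigmaNodeCompositeOr17 := by
  intro W₀ _ _ _ N _ f hW₀ hord L₀ hL₀ q hq hin hout x hx hram lam hlam hlam2 hwp hpar
  exact hN W₀ f hW₀ hord L₀ hL₀ q hq hin hout x hx hram lam hlam hlam2 hwp hpar


/-- **(N256) at ALL levels from the composite-or-17 stub and Setzer** — prime levels `≠ 17` by `SigmaNode.sigmaNode_of_prime_conductor` (tree, p706817: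
every curve of prime conductor `≠ 17` with a formal rational abscissa is a Neumann–Setzer `E₀(u)`, complementary discriminant `−256`). CONDITIONAL on the stubs.
[cite: Setzer1975, pp. 367–378 (main theorem)] [cite: ConradEdixhovenStein2003, Thm. 1.1.1] -/
theorem sigmaNode_of_compositeOr17 (hC : stub_sigmaNodeCompositeOr17) (hS : stub_setzer) : stub_sigmaNode := by
  intro W₀ _ _ N _ f hW₀ hord L₀ hL₀ q hq hin hout x hx hram lam hlam hlam2 hwp hpar
  by_cases hp : (W₀.conductorNorm ℤ).Prime ∧ W₀.conductorNorm ℤ ≠ 17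
  · exact SigmaNode.sigmaNode_of_prime_conductor hS W₀ hp.1 hp.2 f hW₀ hord L₀ hL₀ q hq hin hout x hx hram lam hlam hlam2 hwp hpar
  · have h' : ¬ (W₀.conductorNorm ℤ).Prime ∨ W₀.conductorNorm ℤ = 17 := by
      by_cases h1 : (W₀.conductorNorm ℤ).Prime
      · right; by_contra h2; exact hp ⟨h1, h2⟩
      · left; exact h1
    exact hC W₀ h' f hW₀ hord L₀ hL₀ q hq hin hout x hx hram lam hlam hlam2 hwp hpar

/-- **(SQΣ_f) from the node law (N256)** — `SigmaNode.sigmaSquare_of_sigmaNode` (tree, Theorems/…StarOptBSFSigmaNode) by content, inlined so that the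
skeleton elaborates on older farm snapshots: `4Δ = β²(α² − 32β)` (`four_mul_Δ_eq_of_isTwoTorsionNF_smul`) and `α² − 32β = ±256` give `Δ = ±(8β)²`.
CONDITIONAL on the stub. [cite: SilvermanAEC2009, III.1 and III.2.3] [cite: ConradEdixhovenStein2003, Thm. 1.1.1] -/
theorem sigmaSquare_of_sigmaNode (hN : stub_sigmaNode) : stub_sigmaSquare := by
  intro W₀ _ _ N _ f hW₀ hord L₀ hL₀ q hq hin hout x hx hram lam hlam hlam2 hwp hpar
  have h := hN W₀ f hW₀ hord L₀ hL₀ q hq hin hout x hx hram lam hlam hlam2 hwp hpar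
  obtain ⟨y, hEq, h2⟩ := hx
  set C : WeierstrassCurve.VariableChange ℚ := ⟨1, x, -W₀.a₁ / 2, y⟩ with hC
  have hns : W₀.toAffine.Nonsingular x y := (WeierstrassCurve.Affine.equation_iff_nonsingular).mp hEq
  have hy : y = W₀.toAffine.negY x y := by
    rw [WeierstrassCurve.Affine.negY]; linear_combination h2
  haveI : (C • W₀).IsTwoTorsionNF := WeierstrassCurve.isTwoTorsionNF_smul_of_two_nsmul_eq_zero two_ne_zero hns hy
  have h4Δ := four_mul_Δ_eq_of_isTwoTorsionNF_smul W₀ C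
  have hCr : C.r = x := rfl
  rw [hCr] at h4Δ
  refine ⟨8 * (W₀.b₄ + x * W₀.b₂ + 6 * x ^ 2), ?_⟩
  rcases h with h | h
  · left; linear_combination (1 / 4 : ℚ) * h4Δ + ((W₀.b₄ + x * W₀.b₂ + 6 * x ^ 2) ^ 2 / 4) * h
  · right; linear_combination (1 / 4 : ℚ) * h4Δ + ((W₀.b₄ + x * W₀.b₂ + 6 * x ^ 2) ^ 2 / 4) * h

/-- **(T2′) from (N256) + the prints UBD, Edixhoven ONLY** (v14) — `SigmaNode.partnerNotCentre_of_sigmaNode_free` by name (tree,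
Theorems/…StarOptBSFSigmaNodeSeventeenFree): the `15a1` shape by `3, 5 ∣ Δ_min ⇒ 15 ∣ N`, the `17a1` shape by the explicit 2-power isogeny class of `17a1` + odd transport.
CONDITIONAL on the stubs. [cite: CalegariDimitrovTang2025, Thm. 1.0.1] [cite: Edixhoven1991, Prop. 2] [cite: SilvermanAEC2009, VII.5 Prop. 5.1 (a), Cor. III.4.11 and III.4 Example 4.5] -/
theorem midPartnerNotCentre_of_sigmaNode (hN : stub_sigmaNode) (hU : stub_ubd) (hEd : stub_edixhoven) : stub_midPartnerNotCentre :=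
  SigmaNode.partnerNotCentre_of_sigmaNode_free hU hEd hN

/-- (v13's form, kept for the record) (T2′) from (N256) + UBD, Edixhoven, Setzer, Cremona-17 — `SigmaNode.partnerNotCentre_of_sigmaNode_of_prints`.
CONDITIONAL on the stubs and the two extra prints. [cite: Setzer1975, pp. 367–378] [cite: CremonaAlgorithms1997, Table 1 (N = 17)] -/
theorem midPartnerNotCentre_of_sigmaNode_of_prints (hN : stub_sigmaNode) (hU : stub_ubd) (hEd : stub_edixhoven) (hS : stub_setzer)
    (hC : stub_cremona17) : stub_midPartnerNotCentre :=
  SigmaNode.partnerNotCentre_of_sigmaNode_of_prints hU hEd hS hC hN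

/-- **(T2) from (T2′) — THE MID WALK**, `MidWalk.optimalNotMidPointed_of_partnerNotCentre` by name (tree, Theorems/…StarOptBSFMidWalk), print-free given (T2′).
CONDITIONAL on the stubs. [cite: GreenbergLNM1716, §5 Props. 5.13–5.14 (pp. 120–121)] -/
theorem optimalNotMidPointed_of_sigmaNode (hN : stub_sigmaNode) (hU : stub_ubd) (hEd : stub_edixhoven) : stub_optimalNotMidPointed :=
  MidWalk.optimalNotMidPointed_of_partnerNotCentre (midPartnerNotCentre_of_sigmaNode hN hU hEd)

/-- (T2‴) too is a consequence (trivially, from (T2): a MID point does not exist at all). CONDITIONAL on the stubs. [cite: GreenbergLNM1716, §5 Props. 5.13–5.14] -/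
theorem noSetzerShape_of_sigmaNode (hN : stub_sigmaNode) (hU : stub_ubd) (hEd : stub_edixhoven) : stub_noSetzerShape := by
  intro W _ _ x hord hux htype h15 hsf N _ f hW W₀ _ _ hW₀ L₀ hL₀ q hq hin hout x₀ hx₀ hR₀ hO₀ _
  exact optimalNotMidPointed_of_sigmaNode hN hU hEd W x hord hux htype h15 hsf f hW W₀ hW₀ L₀ hL₀ q hq hin hout x₀ hx₀ hR₀ hO₀

/-- **(T1) from (SQΣ) + UBD + Edixhoven** — `TypeAResidue.optimalNotTypeA_of_sigmaSquare` by name (THEOREM A at 2 inside).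
CONDITIONAL on the stubs. [cite: CalegariDimitrovTang2025, Thm. 1.0.1] [cite: Edixhoven1991, Prop. 2] -/
theorem optimalNotTypeA_of_sigmaSquare (hSQ : stub_sigmaSquare) (hU : stub_ubd) (hEd : stub_edixhoven) : stub_optimalNotTypeA := by
  -- = `TypeAResidue.optimalNotTypeA_of_sigmaSquareFormal hU hEd hSQ` (tree, p703731); inlined so that the skeleton elaborates on older farm snapshots
  intro W₀ _ _ N _ f hW₀ hord L₀ hL₀ q hq hin hout x₀ hu hram
  by_contra hno
  obtain ⟨lam, hlam, hlam2, hwp⟩ := exists_half_period_of_hasRationalTwoTorsionX W₀ L₀ hL₀ hu.1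
  have hpar := ThmAFormal.kummerParity_formal_of_mem_gamma1 hU hEd W₀ f hW₀ L₀ hL₀ q hq hin hout x₀ hu.1 hram lam hlam hlam2 hwp
  obtain ⟨c, hc⟩ := hSQ W₀ f hW₀ hord L₀ hL₀ q hq hin hout x₀ hu.1 hram lam hlam hlam2 hwp hpar
  have hΔ0 : W₀.Δ ≠ 0 := by rw [← W₀.coe_Δ']; exact W₀.Δ'.ne_zero
  rcases hc with hsq | hneg
  · obtain ⟨x₂, hne, hx₂⟩ := TypeAResidue.exists_ne_hasRationalTwoTorsionX_of_Δ_eq_sq W₀ hu.1 hsq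
    exact hne (hu.2 x₂ hx₂)
  · have hc0 : c ≠ 0 := by rintro rfl; exact hΔ0 (by rw [hneg]; ring)
    have hlt : W₀.Δ < 0 := by rw [hneg]; exact neg_neg_of_pos (by positivity)
    exact hno (twoTorsionOdd_of_Δ_neg W₀ hlt hu.1)

/-- **v6's `stub_starOptBSF` from the two position laws (T1) ∧ (T2), PRINT-FREE** — GEN 15's door
`SfPositions.starOptBSF_of_positions` by name. [cite: GreenbergLNM1716, §5 Props. 5.13–5.14 (pp. 120–121)] -/
theorem starOptBSF_of_T12 (hT1 : stub_optimalNotTypeA) (hT2 : stub_optimalNotMidPointed) : stub_starOptBSF :=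
  SfPositions.starOptBSF_of_positions hT1 hT2

/-- v7's `stub_starOptBSFEven` from (T1) ∧ (T2) (drop the even-index clause). [cite: GreenbergLNM1716, §5 Props. 5.13–5.14] -/
theorem starOptBSFEven_of_T12 (hT1 : stub_optimalNotTypeA) (hT2 : stub_optimalNotMidPointed) : stub_starOptBSFEven := by
  intro W _ _ x hord hx hAB h15 hsf N _ f hf _heven W₀ _ _ hf₀ L₀ hL₀ q hq hin hout
  exact starOptBSF_of_T12 hT1 hT2 W x hord hx hAB h15 hsf f hf W₀ hf₀ L₀ hL₀ q hq hin hout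

/-- **GEN 16 (Shimura-exponent door), recorded by name**: at a level `N = pq`, `p ≡ q ≡ 3 (mod 4)`, (T1) and the prints ALONE give the stub's
conclusion — (T2) is automatic there. [cite: Watkins2002, Lemma 3.1] [cite: Stevens1989, §2] -/
theorem starOptBSF_pq3_of_T1 (hT1 : stub_optimalNotTypeA) (hnf : exists_isNewformOf) (hex : stub_gamma1Datum) (hU : stub_ubd)
    {p q' : ℕ} (hp : p.Prime) (hq' : q'.Prime) (hpq : p ≠ q') (hp4 : p % 4 = 3) (hq4 : q' % 4 = 3) [NeZero (p * q')] :
    ∀ (W : WeierstrassCurve ℚ) [W.IsElliptic] [W.IsGloballyMinimal] (x : ℚ), IsOrdinaryAt W 2 →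
      HasUniqueRationalTwoTorsionX W x →
      ((TwoTorsionRamifiedAtTwo x ∧ ¬ TwoTorsionOdd W x) ∨ (TwoTorsionOdd W x ∧ ¬ TwoTorsionRamifiedAtTwo x)) →
      ∀ (f : CuspForm (CongruenceSubgroup.Gamma0 (p * q')) 2), IsNewformOf W f →
      ∀ (W₀ : WeierstrassCurve ℚ) [W₀.IsElliptic] [W₀.IsGloballyMinimal], IsNewformOf W₀ f →
      ∀ (L₀ : PeriodPair), IsNeronLatticeOf (W₀.baseChange ℂ) L₀ → ∀ (q : ℚ), q ≠ 0 →
      (∀ z ∈ periodLattice f, (q : ℂ) * z ∈ L₀.lattice) → (∀ z ∈ L₀.lattice, ∃ w ∈ periodLattice f, z = (q : ℂ) * w) →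
      ∃ x₀ : ℚ, HasRationalTwoTorsionX W₀ x₀ ∧ TwoTorsionOdd W₀ x₀ ∧ ¬ TwoTorsionRamifiedAtTwo x₀ := by
  intro W _ _ x hord hux htype f hW W₀ _ _ hW₀ L₀ hL₀ q hq hin hout
  exact SfShimuraExp.starOptBSF_pq3_of_T1 hnf hex hU hp hq' hpq hp4 hq4 W x hord hux htype f hW W₀ hW₀ L₀ hL₀ q hq hin hout
    (fun x₀ hu hr ↦ hT1 W₀ f hW₀ (Summit.BirchSwinnertonDyer.BirchSwinnertonDyer.Theorems.IsogenyMuShift.isOrdinaryAt_of_isIsogenous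
      (IsNewformOf.isIsogenous WeierstrassCurve.isIsogenous_iff_frobeniusTrace_eq_holds hW hW₀) hord) L₀ hL₀ q hq hin hout x₀ hu hr)

/-- `StarOptB` (aside item 24445, all levels) from its squarefree half and its non-squarefree half `StarOptBNSF` (item 27047), by cases on
`Squarefree N_W`. -/
theorem starOptB_of_halves (hSF : stub_starOptBSF)
    (hNSF : Summit.BirchSwinnertonDyer.BirchSwinnertonDyer.Theses.EisensteinDepletionAtTwo.StarOptBNSF) :
    Summit.BirchSwinnertonDyer.BirchSwinnertonDyer.Theses.EisensteinDepletionAtTwo.StarOptB := by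
  intro W _ _ x hord hx hAB h15 N _ f hf W₀ _ _ hf₀ L₀ hL₀ q hq hin hout
  by_cases hsf : Squarefree (W.conductorNorm ℤ)
  · exact hSF W x hord hx hAB h15 hsf f hf W₀ hf₀ L₀ hL₀ q hq hin hout
  · exact hNSF W x hord hx hAB h15 hsf f hf W₀ hf₀ L₀ hL₀ q hq hin hout

/-- **(T2′) at EVERY level from (N256) + UBD + Edixhoven** (v16) — `SigmaNode.partnerNotCentre_of_sigmaNode_all` by name (tree, Theorems/…StarOptBSigmaNodeFifteenAll,
p728424): the `+256` branch by `false_of_fifteenShape_all` (`W₀ ≅ 15a1`, `N_W = N_{W₀} = 15`), the `−256` branch by `false_of_seventeenShape_free`.  CONDITIONAL on the stubs.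
[cite: CalegariDimitrovTang2025, Thm. 1.0.1] [cite: EdixhovenManin1991, Prop. 2] -/
theorem midPartnerNotCentre_all_of_sigmaNode (hN : stub_sigmaNode) (hU : stub_ubd) (hEd : stub_edixhoven) :
    ∀ (W : WeierstrassCurve ℚ) [W.IsElliptic] [W.IsGloballyMinimal] (x : ℚ), IsOrdinaryAt W 2 →
      HasUniqueRationalTwoTorsionX W x →
      ((TwoTorsionRamifiedAtTwo x ∧ ¬ TwoTorsionOdd W x) ∨ (TwoTorsionOdd W x ∧ ¬ TwoTorsionRamifiedAtTwo x)) →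
      W.conductorNorm ℤ ≠ 15 →
      ∀ ⦃N : ℕ⦄ [NeZero N] (f : CuspForm (CongruenceSubgroup.Gamma0 N) 2), IsNewformOf W f →
      ∀ (W₀ : WeierstrassCurve ℚ) [W₀.IsElliptic] [W₀.IsGloballyMinimal], IsNewformOf W₀ f →
      ∀ (L₀ : PeriodPair), IsNeronLatticeOf (W₀.baseChange ℂ) L₀ → ∀ (q : ℚ), q ≠ 0 →
      (∀ z ∈ periodLattice f, (q : ℂ) * z ∈ L₀.lattice) → (∀ z ∈ L₀.lattice, ∃ w ∈ periodLattice f, z = (q : ℂ) * w) →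
      ∀ (x₀ : ℚ), HasRationalTwoTorsionX W₀ x₀ → TwoTorsionRamifiedAtTwo x₀ → TwoTorsionOdd W₀ x₀ →
      ¬ IsSquare ((W₀.b₄ + x₀ * W₀.b₂ + 6 * x₀ ^ 2) / 2) :=
  SigmaNode.partnerNotCentre_of_sigmaNode_all hU hEd hN

/-- **(T2) at EVERY level — THE MID WALK** (v16), `MidWalk.optimalNotMidPointed_of_partnerNotCentre_all` by name (tree, Theorems/…StarDoorThreePrints), print-free
given (T2′).  CONDITIONAL on the stubs. [cite: GreenbergLNM1716, §5 Props. 5.13–5.14 (pp. 120–121)] -/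
theorem optimalNotMidPointed_all_of_sigmaNode (hN : stub_sigmaNode) (hU : stub_ubd) (hEd : stub_edixhoven) :
    ∀ (W : WeierstrassCurve ℚ) [W.IsElliptic] [W.IsGloballyMinimal] (x : ℚ), IsOrdinaryAt W 2 →
      HasUniqueRationalTwoTorsionX W x →
      ((TwoTorsionRamifiedAtTwo x ∧ ¬ TwoTorsionOdd W x) ∨ (TwoTorsionOdd W x ∧ ¬ TwoTorsionRamifiedAtTwo x)) →
      W.conductorNorm ℤ ≠ 15 →
      ∀ ⦃N : ℕ⦄ [NeZero N] (f : CuspForm (CongruenceSubgroup.Gamma0 N) 2), IsNewformOf W f →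
      ∀ (W₀ : WeierstrassCurve ℚ) [W₀.IsElliptic] [W₀.IsGloballyMinimal], IsNewformOf W₀ f →
      ∀ (L₀ : PeriodPair), IsNeronLatticeOf (W₀.baseChange ℂ) L₀ → ∀ (q : ℚ), q ≠ 0 →
      (∀ z ∈ periodLattice f, (q : ℂ) * z ∈ L₀.lattice) → (∀ z ∈ L₀.lattice, ∃ w ∈ periodLattice f, z = (q : ℂ) * w) →
      ∀ (x₀ : ℚ), HasRationalTwoTorsionX W₀ x₀ → TwoTorsionRamifiedAtTwo x₀ → ¬ TwoTorsionOdd W₀ x₀ :=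
  MidWalk.optimalNotMidPointed_of_partnerNotCentre_all (midPartnerNotCentre_all_of_sigmaNode hN hU hEd)

/-- **`StarOptB` (aside item 24445, EVERY level) from (N256) + UBD + Edixhoven** (v16) — (T1) `optimalNotTypeA_of_sigmaSquare ∘ sigmaSquare_of_sigmaNode` and
(T2)-all-levels glued by `SfPositions.starOptB_of_positions_all` (tree).  No case split on `Squarefree N_W`, no `Γ₁(N)`-datum, no modularity.  (Tree door by name:
`SigmaNode.starOptB_of_sigmaNode_all`.)  CONDITIONAL on the stubs. [cite: GreenbergLNM1716, §5 Props. 5.13–5.14] [cite: CalegariDimitrovTang2025, Thm. 1.0.1] -/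
theorem starOptB_all_of (hN : stub_sigmaNode) (hU : stub_ubd) (hEd : stub_edixhoven) :
    Summit.BirchSwinnertonDyer.BirchSwinnertonDyer.Theses.EisensteinDepletionAtTwo.StarOptB :=
  SfPositions.starOptB_of_positions_all (optimalNotTypeA_of_sigmaSquare (sigmaSquare_of_sigmaNode hN) hU hEd)
    (optimalNotMidPointed_all_of_sigmaNode hN hU hEd)

/-- (v15's form, kept for the record) `StarOptB` from (N256) + modularity + `Γ₁`-datum + UBD + Edixhoven, by cases on `Squarefree N_W`. -/
theorem starOptB_of (hN : stub_sigmaNode) (hnf : exists_isNewformOf)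
    (hex : stub_gamma1Datum) (hU : stub_ubd) (hEd : stub_edixhoven) :
    Summit.BirchSwinnertonDyer.BirchSwinnertonDyer.Theses.EisensteinDepletionAtTwo.StarOptB :=
  starOptB_of_halves (starOptBSF_of_T12 (optimalNotTypeA_of_sigmaSquare (sigmaSquare_of_sigmaNode hN) hU hEd)
    (optimalNotMidPointed_of_sigmaNode hN hU hEd)) (NsfDoorPrint.starOptBNSF_of_print hnf hex hU)

/-! ### Composition (kernel-checked, no sorry): the line concludes the crux BY NAME -/

/-- **COMPOSITION (v18/v19): the five stubs {(F), S2, S4, S5, UBD} — of which S2, S4, S5 are tree theorems in v19 — give E1M `DepletedLambdaLawAtTwoMod` (item 20341) BY NAME.**  E1M's own first binder is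
modularity; with it (OddManin₂) is DERIVED (`oddManinAtTwo_of_stubs`: the parity split), and the v17 door `KummerDoor.depletedLambdaLawAtTwoMod_of_cusp_oddManin_ubd`
((F) + (OddManin₂) + UBD: `StarGO2Sigma` by the re-threaded discrepancy cover, `StarOptB` at every level by the node law, Σ-glue) gives the crux.  Abbes–Ullmo is NOT
an input. [cite: GreenbergVatsal2000, §3 Thm. (3.12), display (28)] [cite: MazurTateTeitelbaum1986Invent, §I.10–I.13] -/
theorem DepletedLambdaLawAtTwoMod_of :
    stub_cuspNonsingular → stub_evenKummerForm → stub_etaleLiftSecondPoint → stub_doubleLiftFalse → stub_ubd →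
    Summit.BirchSwinnertonDyer.BirchSwinnertonDyer.Theses.EisensteinDepletionAtTwo.DepletedLambdaLawAtTwoMod := by
  intro hF h2 h4 h5 hU hmod
  have hnf : exists_isNewformOf := hmod
  exact KummerDoor.depletedLambdaLawAtTwoMod_of_cusp_oddManin_ubd hF (oddManinAtTwo_of_stubs hnf hF hU h2 h4 h5) hU hmod

/-- The crux from the stubs (v19: sorried exactly at the two PRINT stubs `Holds.stub_cuspNonsingular/ubd`; the other three `Holds.stub_*` are proofs). -/
theorem depletedLambdaLawAtTwoMod_star :
    Summit.BirchSwinnertonDyer.BirchSwinnertonDyer.Theses.EisensteinDepletionAtTwo.DepletedLambdaLawAtTwoMod :=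
  DepletedLambdaLawAtTwoMod_of Holds.stub_cuspNonsingular Holds.stub_evenKummerForm Holds.stub_etaleLiftSecondPoint
    Holds.stub_doubleLiftFalse Holds.stub_ubd

/- RECORD (not elaborated: the skeleton checker admits exactly one crux-concluding composition besides `depletedLambdaLawAtTwoMod_star`).
⟨doc⟩ (v16's form, kept for the record) E1M from {(F), Abbes–Ullmo, UBD} (+ Edixhoven, a proof): `StarGO2Sigma` by line kummer's door
(`KummerDoor.starGO2Sigma_of_modularity_abbesUllmo_ubd`), `StarOptB` at every level by `starOptB_all_of`, and the Σ-glue.  (Tree door by name: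
`SigmaNode.depletedLambdaLawAtTwoMod_of_threePrints`.) [cite: GreenbergVatsal2000, §3 Thm. (3.12), display (28)] [cite: MazurTateTeitelbaum1986Invent, §I.10–I.13] ⟨/doc⟩
theorem DepletedLambdaLawAtTwoMod_of_v16 :
    stub_cuspNonsingular → stub_abbesUllmo → stub_ubd → stub_edixhoven →
    Summit.BirchSwinnertonDyer.BirchSwinnertonDyer.Theses.EisensteinDepletionAtTwo.DepletedLambdaLawAtTwoMod := by
  intro hF hAU hU hEd hmod
  have hnf : exists_isNewformOf := hmod
  have hN : stub_sigmaNode := sigmaNode_of_cuspNonsingular hF hEd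
  exact depletedLambdaLawAtTwoMod_of_starGO2Sigma (KummerDoor.starGO2Sigma_of_modularity_abbesUllmo_ubd hnf hAU hU)
    (starOptB_all_of hN hU hEd) hmod

⟨doc⟩ (Consistency, v17) v16's inputs still close the crux through the v17 composition: A–U ⇒ (OddManin₂). [cite: AbbesUllmo1996, Thm. A] ⟨/doc⟩
theorem DepletedLambdaLawAtTwoMod_of_threePrints_v17 :
    stub_cuspNonsingular → stub_abbesUllmo → stub_ubd →
    Summit.BirchSwinnertonDyer.BirchSwinnertonDyer.Theses.EisensteinDepletionAtTwo.DepletedLambdaLawAtTwoMod :=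
  fun hF hAU hU ↦ DepletedLambdaLawAtTwoMod_of hF (stub_oddManinAtTwo_of_abbesUllmo hAU) hU

-/

end Summit.BirchSwinnertonDyer.BirchSwinnertonDyer.Cruxes.DepletedLambdaLawAtTwoMod.Star
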